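import Mathlib
import Literature.MathematicalPhysics.QuantumFieldTheory.Balaban1983to89.B14Eq350KernelCauchy
import Literature.MathematicalPhysics.QuantumFieldTheory.Balaban1983to89.B14Eq360TensorInvariance

/-!
# `Balaban1983to89.B14.Eq358TranslInv` — T. Bałaban, *Convergent renormalization expansions for lattice gauge theories*,
# Commun. Math. Phys. **119** (1988) 243–285 [Balaban1988Convergent]: p. 281 *"This function is translation invariant,
# hence Π^{(j)}_{μν,κλ} is independent of z"* PROVED from the paper's own justification, the Euclidean covariance (2.29)
# of the whole-lattice density in its reformulation (3.58), for translations — the hypothesis `TranslInv` of the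
# (3.61) ⇒ (3.64) chain (`B14.Eq364Beta.eq364`, …, `B14.Eq350KernelCauchy.eq364_kernelOf`) DERIVED; v1.1: (3.58) for the
# axis reflections and coordinate permutations ⇒ the covariances (3.59) of the whole-lattice kernel ⇒ (3.60)/(3.61) with
# every hypothesis of `B14.Eq360TensorInvariance.eq361_of_covariance` discharged; v1.2: the located model caveat
# KERNEL-CHECKED — in the `z`-independent model `TranslInv` + `Decay3` force the whole-lattice kernel to vanish (`M ≥ 2`)

statement-level skeleton of published theorems with citation tags; proofs where landed; nothing here is a claim about the Yang–Mills mass gap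

PDF held: `paper:balaban1988-cmp119-convergent-renormalization` (journal page = PDF page + 242); pp. 259–260 [PDF 17–18]
and pp. 281–282 [PDF 39–40] re-read for this file (`lit read … --pages 17-18`, `--pages 39-41`).

CITATION HEADER (lean-in-tree rule).  WHAT IS REPRODUCED, verbatim.  [Balaban1988Convergent] p. 281: *"Here Π^{(j)}_{μν,κλ}
= Σ_{x,y} Π^{(j)}_{μν}(x, y, z)(x_κ − z_κ)(y_λ − z_λ), and the function Π^{(j)}_{μν}(x, y, z) is given by the formula (3.50),
but with 𝐄^{(j)}(X, U_j, z) replaced by 𝐄^{(j)}(U_j, z) defined on the whole lattice L⁻ʲZ^d. This function is translation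
invariant, hence Π^{(j)}_{μν,κλ} is independent of z. Let us describe its other properties. The most important one is the
Euclidean covariance following from (2.29). It can be reformulated as 𝐄^{(j)}(U_j(exp irB), rz) = 𝐄^{(j)}(U_j(exp iB), z),
(3.58) where rB represents the configuration (rB)_μ(x) = (rB)_μ(r⁻¹x)."*; p. 260: *"The last important property is the
Euclidean covariance. We have it only for functions 𝐄^{(j)}(U_j, z) defined by the equality (2.27) with the unrestricted
summation, i.e., with the sum over all X ∈ 𝐃_j containing the point z. These functions satisfy the equality 𝐄^{(j)}(rU_j,
rz) = 𝐄^{(j)}(U_j, z) (2.29) for arbitrary Euclidean transformations r of the lattice T_1^{(j)}, and for regular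
configurations U_j."*; (2.27) p. 259: *"𝐄^{(j)}(Λ_j, U_k, z) = Σ_{X∋z} 𝐄^{(j)}(X, U_k, z) … The term 𝐄^{(j)}(X, U_k, z) of the
last sum has the following properties: (i) it depends on U_k restricted to X; (ii) there exists an analytic function
𝐄^{(j)}(X, (𝐔, 𝐉), z) … which is an extension of this term …; (iv) it satisfies the inequality (I.1.18)."*; (3.50) p. 280:
*"𝐄^{(2)}_{μν}(X, x, y, z) = (δ²/δB_μ(x)δB_ν(y)) 𝐄^{(j)}(X, U_j(exp iB), z)|_{B=0}"*.

SKELETON rows (owner r11): **B14.Eq3.55–3.57** (the p. 281 sentence), **B14.Eq3.58–3.61** ((3.58)), **B14.Eq3.62–3.64**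
(the input `TranslInv` of (3.62)–(3.64)).

WHY A NEW FILE.  The chain of record carries *"This function is translation invariant"* as the HYPOTHESIS
`B14.Eq364Beta.TranslInv P3` (`Eq362Marginals.eq364_of_WT`, `Eq362KernelWard.eq364_threeKernel_of_ward`,
`Eq350KernelCauchy.eq364_kernelOf`).  Print justifies it by (2.29), which p. 260 states for the whole-lattice function
`𝐄^{(j)}(U_j, z)` — the (2.27)-series with the UNRESTRICTED summation — and *"for arbitrary Euclidean transformations r"*;
its `B`-field reformulation is (3.58).  Term by term (one localization domain `X` at a time, `X` a union of cubes of the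
fixed partition) no such covariance holds — the partition is not translation invariant — which is why p. 260 insists on
the unrestricted sum.  THIS FILE takes (3.58) for the translations `r = τ_a` (`r z = z + a`, `(rB)_μ(x) = B_μ(x − a)`) as
the hypothesis, stated on the whole-lattice DENSITY of an analytic localized family, and PROVES from it the translation
invariance of the whole-lattice three-point kernel and the `z`-independence of `Π^{(j)}_{μν,κλ}`.  The per-domain terms
carry their point `z` (print: `𝐄^{(j)}(X, U_j, z)`); `B14.Eq357KernelDecay`'s kernel family `K X μ ν x y` is *"(any fixed
z)"*, so the whole-lattice kernel of a `z`-pointed family `g X z` is `z ↦ threeKernel M (kernelOf M (g · z)) μ ν x y z`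
(`kernelPt`, §3) — every per-`z` theorem of `B14.Eq357KernelDecay`/`Eq362KernelWard`/`Eq350KernelCauchy` applies to it
verbatim.
WHAT IS PROVED (no `sorry`; `def`s with bodies; nothing existing is modified):
* §1 slice-derivative bookkeeping for `PolydiscCauchyBounds.pderiv`: `pderiv_eq_deriv_line` (`∂_b G(v) = d/du G(v + ue_b)|₀`),
  `lin`/`pderiv_comp_lin` (slice derivatives of `G ∘ L` for `L w = Σ_i w_i e_{c i}`), `pderiv_congr_of_eventuallyEq`,
  `pderiv_eq_zero_of_forall_update`, `pderiv_update_of_forall_update` (independence of a coordinate is inherited);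
* §2 **term-by-term differentiation of a normally convergent series of analytic functions of finitely many complex
  variables**, at the centre of a polydisc: `hasSum_pderiv` (first slice derivatives, on the half polydisc) and
  `hasSum_pderiv_pderiv` (`∂_a∂_b Σ_i φ_i (0) = Σ_i ∂_a∂_b φ_i(0)`), from Mathlib's one-variable
  `Complex.hasSum_deriv_of_summable_norm` applied twice and the Cauchy bound `PolydiscCauchyBounds.norm_pderiv_le` for the
  majorant of the first derivatives — the analytic content of *"(3.50) … with 𝐄^{(j)}(X, U_j, z) replaced by 𝐄^{(j)}(U_j, z)"*
  (the kernel of the series is the series of the kernels), carried as a definition (model note M1″) in `B14.Eq357KernelDecay`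
  and PROVED here for analytic localized families;
* §3 the `z`-pointed analytic localized family `g X z` ((2.27)(i)(ii)), its whole-lattice density `density M g z B =
  Σ'_{X ∋ cube z} g X z (B↾X)` ((2.27) unrestricted, p. 260), the translations `shift a B` of configurations, the hypothesis
  **`Eq358Transl M g R`** = (3.58) for `r = τ_a` on the regular configurations `sup|B_μ(x)| < R`, and the whole-lattice kernel
  `kernelPt M g`;
* §4 two-bond probes `probe b₁ b₂ w = w₀δ_{b₁} + w₁δ_{b₂}` and **`kernelPt_eq_re_pderiv`**: `Π_{μν}(x, y, z) = Re ∂₀∂₁ [w ↦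
  𝐄^{(j)}(U_j(exp i·probe_{(μ,x),(ν,y)} w), z)](0)` — the whole-lattice kernel IS the second derivative of the whole-lattice
  density (§2 with the majorant `E₀e^{−κd_j(X)}` of (2.27)(iv) and [II] (1.26) `B14.Eq357KernelDecay.summable_expAbove`);
* §5 **`translInv_kernelPt`**: (3.58) for translations ⇒ `TranslInv (kernelPt M g)` (*"This function is translation
  invariant"*); `P4At`/`P4At_eq_P4` (*"hence Π^{(j)}_{μν,κλ} is independent of z"*, for any translation invariant kernel);
  **`eq364_kernelPt`**: `β′_j = β_j` ((3.61)–(3.64)) for the whole-lattice kernel of a pointed analytic localized family with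
  `TranslInv` DISCHARGED — remaining inputs: the per-domain data (2.27)(i)–(iv) (linearized (iii) as in
  `B14.Eq350KernelCauchy` (M7)), (3.58) for translations, and [I]'s Taylor data (I.5.16) of the summed kernel (3.63);
* §6 (v1.1) the rest of (3.58): `reflPt`/`reflCfg`/**`Eq358Refl`** ((3.58) for the axis reflections `r_α`, p. 282: *"if r is
  the reflection in the hyperplane x_μ = 0, then (rB)_μ(x) = −B_μ((…, −x_μ − 1, …))"* — `(r_αB)_μ(x) = s_α(μ)B_μ(r_{α,μ}x)` with
  `B14.Eq360TensorInvariance.reflSrc`, `B14Sect3.axisSign`), `permCfg`/**`Eq358Perm`** ((3.58) for the coordinate permutations,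
  `B14.Eq360TensorInvariance.permPt`); `pderiv_comp_diag`, `reflCfg_probe`/`permCfg_probe` (the transformed probe is the
  sign-twisted probe at the transformed bonds); **`kernelPt_refl`**, **`kernelPt_perm`** = **(3.59)** *"((r⁻¹⊗r⁻¹)Π^{(j)}_{μν})(rx,
  ry, rz) = Π^{(j)}_{μν}(x, y, z)"* for the whole-lattice kernel, PROVED from (3.58); **`eq361_kernelPt`**: (3.59) ⇒ (3.60) ⇒
  (3.61) `Π_{μν,κτ} = δ_{μν}δ_{κτ}Π_{μ₀μ₀,κ₀κ₀}` (`κ < μ`, `τ < ν`) — `B14.Eq360TensorInvariance.eq361_of_covariance` with `hD`,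
  `hWx`, `hWy`, `hR`, `hP` ALL DISCHARGED to (2.27)(i)–(iv) and (3.58);
* §7 (v1.2) **the located model caveat, kernel-checked**: in the `z`-INDEPENDENT model of `B14.Eq357KernelDecay` (one family
  `K X μ ν x y` for every `z`) the whole-lattice kernel sees `z` only through its cube (`threeKernel_congr_coarse`), so
  `TranslInv` makes it independent of `z` when `M ≥ 2` (`threeKernel_step_of_translInv`, `eq_apply_zero_of_step`,
  `threeKernel_eq_apply_zero_of_translInv`) and `Decay3` then forces it to VANISH (`threeKernel_eq_zero_of_translInv`; for
  analytic families `threeKernel_kernelOf_eq_zero_of_translInv`): the `z`-independent theorems that carry `TranslInv` as a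
  hypothesis (`B14.Eq357KernelDecay.eq364_threeKernel`, `B14.Eq362KernelWard.eq364_threeKernel_of_ward`,
  `B14.Eq350KernelCauchy.eq364_kernelOf`) speak about the zero kernel only — the faithful carrier is the `z`-pointed `kernelPt`,
  for which translation invariance is the THEOREM `translInv_kernelPt`.
Model notes (declared).  (M8) (3.58) enters on the open sup-ball of radius `R` (the polydisc of (2.27)(ii),
`B14.Eq350KernelCauchy` (M5)) for the translations (§5), the axis reflections and the coordinate permutations (§6) — generators
of the Euclidean group of the lattice `Z^d` (print: *"for arbitrary Euclidean transformations r"*); the abstract (2.29) ⇒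
(3.58) ⇒ (3.59) bookkeeping for ONE function is `B14.Eq358Covariance` and is not touched.  (M9) the point `z` of `𝐄^{(j)}(X,
U_j, z)` is an argument of the family (`g X z`); membership *"X ∋ z"* is carried by the cube of `z` as in `B14.Eq357KernelDecay`
(M2″).  (M5)–(M7), (M1′), (M2′), (M4″) as in `B14.Eq350KernelCauchy`.

**Version.**  v1.2 — ADDITIVE to v1.1 (p256328; v1 = p256143): + §7 (theorems only); every v1/v1.1 declaration
byte-identical.  v1.1 — ADDITIVE to v1: + §6.

Mega-formalization `lit-balaban`, unit `lit-balaban-r11` gen 6 (B14 fold owner), HOME `run/shared/lean/pub/lit-balaban/`.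

## References
* [Balaban1988Convergent] T. Bałaban, Commun. Math. Phys. 119 (1988) 243–285, (2.27) p.259, (2.29) p.260, (3.50) p.280,
  p.281, (3.58)–(3.61) p.282, (3.62)–(3.64) pp.282–283.
* [Balaban1987RG1] T. Bałaban, Commun. Math. Phys. 109 (1987) 249–301 ([I]: (1.18) p.261, (4.15) p.284, (5.16)).
* [Balaban1988RG2Cluster] T. Bałaban, Commun. Math. Phys. 116 (1988) 1–22 ([II]: (1.26) p.8).
* [Dimock2013] J. Dimock, Rev. Math. Phys. 25 (2013) 1330010, §4.5 (polydisc Cauchy bounds; `PolydiscCauchyBounds`).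
-/

namespace Literature.MathematicalPhysics.QuantumFieldTheory.Balaban1983to89.B14.Eq358TranslInv

noncomputable section

open Literature.MathematicalPhysics.QuantumFieldTheory.Balaban1983to89
open Literature.MathematicalPhysics.QuantumFieldTheory.Balaban1983to89.B13ScaleTransfer
open Literature.MathematicalPhysics.QuantumFieldTheory.Balaban1983to89.TreeLength
open Literature.MathematicalPhysics.QuantumFieldTheory.Balaban1983to89.B12TreeDecay
open Literature.MathematicalPhysics.QuantumFieldTheory.Balaban1983to89.B14.Eq364Beta
open Literature.MathematicalPhysics.QuantumFieldTheory.Balaban1983to89.B14.Eq357KernelDecay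
open Literature.MathematicalPhysics.QuantumFieldTheory.Balaban1983to89.B14.Eq362KernelWard
open Literature.MathematicalPhysics.QuantumFieldTheory.Balaban1983to89.B14.Eq350KernelCauchy
open Literature.MathematicalPhysics.QuantumFieldTheory.Balaban1983to89.B14.Eq362Marginals (grad)
open Literature.MathematicalPhysics.QuantumFieldTheory.Balaban1983to89.B14.Eq360TensorInvariance (P4)
open Literature.MathematicalPhysics.QuantumFieldTheory.Dimock2011to13.PolydiscCauchyBounds
open _root_.Filter _root_.Topology _root_.Metric Function Finset

/-! ## §1. Slice derivatives: bookkeeping -/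

section Slices

variable {ι : Type*} [Fintype ι] [DecidableEq ι] {F : Type*} [NormedAddCommGroup F] [NormedSpace ℂ F]

omit [Fintype ι] in
/-- Updating one coordinate is a translation along the coordinate vector: `s[b ↦ t] = s + (t − s_b)e_b`.
[cite: Dimock2013, §4.5 L2379 (arXiv:1108.1335v2 TeX)] -/
theorem update_eq_add_smul_single (s : ι → ℂ) (b : ι) (t : ℂ) :
    update s b t = s + (t - s b) • (Pi.single b (1 : ℂ) : ι → ℂ) := by
  funext j
  by_cases hj : j = b
  · subst hj
    simp
  · simp [update_of_ne hj, Pi.single_eq_of_ne hj]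

omit [Fintype ι] in
/-- The slice derivative `∂_b G(v)` is the derivative at `0` of `u ↦ G(v + ue_b)`.
[cite: Dimock2013, §4.5 L2379 (arXiv:1108.1335v2 TeX)] -/
theorem pderiv_eq_deriv_line (b : ι) (G : (ι → ℂ) → F) (v : ι → ℂ) :
    pderiv b G v = deriv (fun u : ℂ => G (v + u • (Pi.single b (1 : ℂ) : ι → ℂ))) 0 := by
  unfold pderiv
  have h : (fun t : ℂ => G (update v b t))
      = fun t : ℂ => (fun u : ℂ => G (v + u • (Pi.single b (1 : ℂ) : ι → ℂ))) (t - v b) := by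
    funext t
    rw [update_eq_add_smul_single]
  rw [h]
  have key := deriv_comp_sub_const (f := fun u : ℂ => G (v + u • (Pi.single b (1 : ℂ) : ι → ℂ))) (a := v b)
    (x := v b)
  rw [sub_self] at key
  exact key

/-- The linear span map of a finite family of coordinate vectors: `L_c(w) = Σ_i w_i e_{c i}`.
[cite: Balaban1988Convergent, (3.50) p.280] -/
def lin {n : ℕ} (c : Fin n → ι) (w : Fin n → ℂ) : ι → ℂ := ∑ i, w i • (Pi.single (c i) (1 : ℂ) : ι → ℂ)

omit [Fintype ι] in
/-- Updating a coefficient translates the span map along the corresponding coordinate vector.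
[cite: Balaban1988Convergent, (3.50) p.280] -/
theorem lin_update {n : ℕ} (c : Fin n → ι) (w : Fin n → ℂ) (i : Fin n) (t : ℂ) :
    lin c (update w i t) = lin c w + (t - w i) • (Pi.single (c i) (1 : ℂ) : ι → ℂ) := by
  unfold lin
  rw [update_eq_add_smul_single w i t]
  simp only [Pi.add_apply, Pi.smul_apply, smul_eq_mul, add_smul, sum_add_distrib]
  congr 1
  rw [Finset.sum_eq_single i]
  · simp
  · intro j _ hj
    simp [Pi.single_eq_of_ne hj]
  · intro h
    exact absurd (mem_univ i) h

omit [Fintype ι] in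
/-- **Slice derivatives of a pull-back along coordinate vectors**: `∂_i (H ∘ L_c)(w) = (∂_{c i} H)(L_c w)`.
[cite: Balaban1988Convergent, (3.50) p.280] -/
theorem pderiv_comp_lin {n : ℕ} (c : Fin n → ι) (H : (ι → ℂ) → F) (w : Fin n → ℂ) (i : Fin n) :
    pderiv i (fun w' : Fin n → ℂ => H (lin c w')) w = pderiv (c i) H (lin c w) := by
  rw [pderiv_eq_deriv_line (c i) H]
  unfold pderiv
  have h : (fun t : ℂ => H (lin c (update w i t)))
      = fun t : ℂ => (fun u : ℂ => H (lin c w + u • (Pi.single (c i) (1 : ℂ) : ι → ℂ))) (t - w i) := by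
    funext t
    rw [lin_update]
  rw [h]
  have key := deriv_comp_sub_const (f := fun u : ℂ => H (lin c w + u • (Pi.single (c i) (1 : ℂ) : ι → ℂ)))
    (a := w i) (x := w i)
  rw [sub_self] at key
  exact key

/-- Slice derivatives only see the germ: functions that agree near `v` have the same `∂_i` at `v`.
[cite: Dimock2013, §4.5 L2379 (arXiv:1108.1335v2 TeX)] -/
theorem pderiv_congr_of_eventuallyEq {Φ₁ Φ₂ : (ι → ℂ) → F} {v : ι → ℂ} (h : Φ₁ =ᶠ[𝓝 v] Φ₂) (i : ι) :
    pderiv i Φ₁ v = pderiv i Φ₂ v := by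
  unfold pderiv
  apply Filter.EventuallyEq.deriv_eq
  have ht : Tendsto (fun t : ℂ => update v i t) (𝓝 (v i)) (𝓝 v) := by
    have hc := (hasDerivAt_update v i (v i)).continuousAt.tendsto
    rwa [update_eq_self] at hc
  exact ht.eventually h

/-- On an open set where two functions agree, their slice derivatives agree.
[cite: Dimock2013, §4.5 L2379 (arXiv:1108.1335v2 TeX)] -/
theorem pderiv_congr_of_eqOn {Φ₁ Φ₂ : (ι → ℂ) → F} {S : Set (ι → ℂ)} (hS : IsOpen S) (h : Set.EqOn Φ₁ Φ₂ S)
    (i : ι) {v : ι → ℂ} (hv : v ∈ S) : pderiv i Φ₁ v = pderiv i Φ₂ v :=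
  pderiv_congr_of_eventuallyEq (h.eventuallyEq_of_mem (hS.mem_nhds hv)) i

omit [Fintype ι] in
/-- A function independent of the coordinate `i` has `∂_i = 0`. [cite: Dimock2013, §4.5 L2379 (arXiv:1108.1335v2 TeX)] -/
theorem pderiv_eq_zero_of_forall_update {φ : (ι → ℂ) → F} {i : ι} (h : ∀ v t, φ (update v i t) = φ v) (v : ι → ℂ) :
    pderiv i φ v = 0 := by
  unfold pderiv
  simp_rw [h]
  exact deriv_const _ _

omit [Fintype ι] in
/-- Independence of the coordinate `i` is inherited by every slice derivative.
[cite: Dimock2013, §4.5 L2379 (arXiv:1108.1335v2 TeX)] -/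
theorem pderiv_update_of_forall_update {φ : (ι → ℂ) → F} {i : ι} (h : ∀ v t, φ (update v i t) = φ v) (j : ι)
    (v : ι → ℂ) (t : ℂ) : pderiv j φ (update v i t) = pderiv j φ v := by
  by_cases hji : j = i
  · subst hji
    rw [pderiv_eq_zero_of_forall_update h, pderiv_eq_zero_of_forall_update h]
  · unfold pderiv
    rw [update_of_ne hji]
    congr 1
    funext r
    rw [update_comm (Ne.symm hji), h]

end Slices

/-! ## §2. Term-by-term differentiation of a normally convergent series of analytic functions -/

section Series

variable {κι : Type*} [Fintype κι] [DecidableEq κι] {ι : Type*}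

/-- **First slice derivatives of a normally convergent series**: if every `φ_i` is analytic on an open `V` containing the
closed polydisc of radius `ρ > 0` and `‖φ_i‖ ≤ u_i` there with `Σu_i < ∞`, then at every point `w` of the polydisc with
`|w_b| < ρ` the series of the `∂_b φ_i(w)` converges to `∂_b(Σ_i φ_i)(w)` (Mathlib's one-variable theorem on the slice).
[cite: Balaban1988Convergent, p.281 (Π given by (3.50) with 𝐄^{(j)}(X,U_j,z) replaced by 𝐄^{(j)}(U_j,z))] -/
theorem hasSum_pderiv {φ : ι → (κι → ℂ) → ℂ} {V : Set (κι → ℂ)} (hφ : ∀ i, AnalyticOnNhd ℂ (φ i) V)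
    {ρ : ℝ} (hρV : polydisc (fun _ : κι => ρ) ⊆ V) {u : ι → ℝ} (hu : Summable u)
    (hle : ∀ i, ∀ w ∈ polydisc (fun _ : κι => ρ), ‖φ i w‖ ≤ u i) (b : κι) {w : κι → ℂ}
    (hw : w ∈ polydisc (fun _ : κι => ρ)) (hwb : ‖w b‖ < ρ) :
    HasSum (fun i => pderiv b (φ i) w) (pderiv b (fun v => ∑' i, φ i v) w) := by
  have mem_of : ∀ t ∈ ball (0 : ℂ) ρ, update w b t ∈ polydisc (fun _ : κι => ρ) := by
    intro t ht j
    by_cases hj : j = b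
    · subst hj
      rw [update_self]
      exact (mem_ball_zero_iff.1 ht).le
    · rw [update_of_ne hj]
      exact hw j
  have hdiff : ∀ i, DifferentiableOn ℂ (fun t : ℂ => φ i (update w b t)) (ball (0 : ℂ) ρ) := fun i t ht =>
    (((hφ i) _ (hρV (mem_of t ht))).differentiableAt.comp t
      (hasDerivAt_update w b t).differentiableAt).differentiableWithinAt
  have hbd : ∀ (i : ι) (t : ℂ), t ∈ ball (0 : ℂ) ρ → ‖φ i (update w b t)‖ ≤ u i := fun i t ht =>
    hle i _ (mem_of t ht)
  have key := Complex.hasSum_deriv_of_summable_norm (F := fun i (t : ℂ) => φ i (update w b t)) hu hdiff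
    isOpen_ball hbd (mem_ball_zero_iff.2 hwb)
  exact key

/-- **Second slice derivatives of a normally convergent series, at the centre**: under the hypotheses of `hasSum_pderiv`
(`ρ > 0`), `Σ_i ∂_a∂_b φ_i(0)` converges to `∂_a∂_b(Σ_i φ_i)(0)` — the one-variable theorem again, on the slice through the
centre, with the Cauchy majorant `2u_i/ρ` of the first derivatives on the half polydisc (`norm_pderiv_le`).
[cite: Balaban1988Convergent, p.281 (Π given by (3.50) with 𝐄^{(j)}(X,U_j,z) replaced by 𝐄^{(j)}(U_j,z))] -/
theorem hasSum_pderiv_pderiv {φ : ι → (κι → ℂ) → ℂ} {V : Set (κι → ℂ)} (hV : IsOpen V)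
    (hφ : ∀ i, AnalyticOnNhd ℂ (φ i) V) {ρ : ℝ} (hρ : 0 < ρ) (hρV : polydisc (fun _ : κι => ρ) ⊆ V) {u : ι → ℝ}
    (hu : Summable u) (hle : ∀ i, ∀ w ∈ polydisc (fun _ : κι => ρ), ‖φ i w‖ ≤ u i) (a b : κι) :
    HasSum (fun i => pderiv a (pderiv b (φ i)) 0) (pderiv a (pderiv b (fun v => ∑' i, φ i v)) 0) := by
  have hρ2 : ρ / 2 < ρ := by linarith
  -- the points of the slice through the centre along `e_a`, for `|t| < ρ/2`
  have mem_of : ∀ t : ℂ, ‖t‖ < ρ / 2 →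
      update (0 : κι → ℂ) a t ∈ polydisc (update (fun _ : κι => ρ) b (ρ / 2)) := by
    intro t ht j
    by_cases hja : j = a
    · subst hja
      rw [update_self]
      by_cases hjb : j = b
      · subst hjb
        rw [update_self]
        exact ht.le
      · rw [update_of_ne hjb]
        linarith [ht.le]
    · rw [update_of_ne hja, Pi.zero_apply, norm_zero]
      by_cases hjb : j = b
      · subst hjb
        rw [update_self]
        linarith
      · rw [update_of_ne hjb]
        linarith
  have mem_of' : ∀ t : ℂ, ‖t‖ < ρ / 2 → update (0 : κι → ℂ) a t ∈ polydisc (fun _ : κι => ρ) := by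
    intro t ht
    refine polydisc_mono (fun j => ?_) (mem_of t ht)
    by_cases hjb : j = b
    · subst hjb
      rw [update_self]
      linarith
    · rw [update_of_ne hjb]
  -- step 1: the first derivatives along the slice
  have step1 : ∀ t : ℂ, ‖t‖ < ρ / 2 →
      HasSum (fun i => pderiv b (φ i) (update (0 : κι → ℂ) a t))
        (pderiv b (fun v => ∑' i, φ i v) (update (0 : κι → ℂ) a t)) := by
    intro t ht
    refine hasSum_pderiv hφ hρV hu hle b (mem_of' t ht) ?_
    by_cases hba : b = a
    · subst hba
      rw [update_self]
      linarith
    · rw [update_of_ne hba, Pi.zero_apply, norm_zero]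
      exact hρ
  -- step 2: the Cauchy majorant of the first derivatives and the one-variable theorem on the slice
  have hG : ∀ (i : ι) (t : ℂ), t ∈ ball (0 : ℂ) (ρ / 2) →
      ‖pderiv b (φ i) (update (0 : κι → ℂ) a t)‖ ≤ u i / (ρ - ρ / 2) := fun i t ht =>
    norm_pderiv_le (ρ := fun _ : κι => ρ) (hφ i) hρV (hle i) b hρ2 (mem_of t (mem_ball_zero_iff.1 ht))
  have hu' : Summable fun i => u i / (ρ - ρ / 2) := hu.div_const _
  have hdiff : ∀ i, DifferentiableOn ℂ (fun t : ℂ => pderiv b (φ i) (update (0 : κι → ℂ) a t))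
      (ball (0 : ℂ) (ρ / 2)) := fun i t ht =>
    (((analyticOnNhd_pderiv hV (hφ i) b) _ (hρV (mem_of' t (mem_ball_zero_iff.1 ht)))).differentiableAt.comp t
      (hasDerivAt_update (0 : κι → ℂ) a t).differentiableAt).differentiableWithinAt
  have key := Complex.hasSum_deriv_of_summable_norm
    (F := fun i (t : ℂ) => pderiv b (φ i) (update (0 : κι → ℂ) a t)) hu' hdiff isOpen_ball hG
    (mem_ball_self (half_pos hρ))
  have hcongr : (fun t : ℂ => ∑' i, pderiv b (φ i) (update (0 : κι → ℂ) a t))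
      =ᶠ[𝓝 (0 : ℂ)] fun t : ℂ => pderiv b (fun v => ∑' i, φ i v) (update (0 : κι → ℂ) a t) := by
    filter_upwards [ball_mem_nhds (0 : ℂ) (half_pos hρ)] with t ht
    exact (step1 t (mem_ball_zero_iff.1 ht)).tsum_eq
  rw [hcongr.deriv_eq] at key
  exact key

end Series

/-! ## §3. Pointed analytic localized families, the whole-lattice density, (3.58) for translations -/

variable {d : ℕ}

/-- Restriction of a whole-lattice configuration of complex bond components `B_μ(x)` to the sites of the cubes of `X`
((2.27)(i): *"it depends on U_k restricted to X"*). [cite: Balaban1988Convergent, (2.27)(i) p.259] -/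
def restr (M : ℕ) (X : Finset (Pt d)) (B : Fin d × Pt d → ℂ) : Fin d × ↥(sites M X) → ℂ :=
  fun p => B (p.1, (p.2 : Pt d))

/-- The translated configuration `(rB)_μ(x) = B_μ(r⁻¹x) = B_μ(x − a)` for `r = τ_a` (p. 282: *"rB represents the
configuration (rB)_μ(x) = (rB)_μ(r⁻¹x)"*). [cite: Balaban1988Convergent, (3.58) p.282] -/
def shift (a : Pt d) (B : Fin d × Pt d → ℂ) : Fin d × Pt d → ℂ := fun p => B (p.1, p.2 - a)

/-- **The whole-lattice density** `𝐄^{(j)}(U_j(exp iB), z) = Σ_{X ∋ z} 𝐄^{(j)}(X, U_j(exp iB), z)` ((2.27) with the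
unrestricted summation, p. 260) of a `z`-pointed analytic localized family `g X z` = the analytic extension (2.27)(ii) of
`B ↦ 𝐄^{(j)}(X, U_j(exp iB), z)` in the bond components over the sites of `X`; *"X ∋ z"* by the cube of `z` (M9).
[cite: Balaban1988Convergent, (2.27) p.259, (2.29) p.260] -/
def density (M : ℕ) (g : ∀ X : Finset (Pt d), Pt d → (Fin d × ↥(sites M X) → ℂ) → ℂ) (z : Pt d)
    (B : Fin d × Pt d → ℂ) : ℂ :=
  ∑' X : LocDom d, if coarse M z ∈ X.1 then g X.1 z (restr M X.1 B) else 0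

/-- **(3.58) for translations** (the hypothesis of this file): `𝐄^{(j)}(U_j(exp irB), rz) = 𝐄^{(j)}(U_j(exp iB), z)` for
`r = τ_a`, every `a`, on the regular configurations `sup|B_μ(x)| < R` (M8) — the Euclidean covariance (2.29) of the
whole-lattice density, reformulated. [cite: Balaban1988Convergent, (3.58) p.282, (2.29) p.260] -/
def Eq358Transl (M : ℕ) (g : ∀ X : Finset (Pt d), Pt d → (Fin d × ↥(sites M X) → ℂ) → ℂ) (R : ℝ) : Prop :=
  ∀ (a z : Pt d) (B : Fin d × Pt d → ℂ), (∀ p, ‖B p‖ < R) → density M g (z + a) (shift a B) = density M g z B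

/-- **The whole-lattice three-point kernel** `Π^{(j)}_{μν}(x, y, z)` of a pointed family: *"given by the formula (3.50), but
with 𝐄^{(j)}(X, U_j, z) replaced by 𝐄^{(j)}(U_j, z)"* — at the point `z`, the `X`-series (`B14.Eq357KernelDecay.threeKernel`)
of the (3.50) kernels (`B14.Eq350KernelCauchy.kernelOf`) of the family `X ↦ g X z`.
[cite: Balaban1988Convergent, p.281 (the function Π^{(j)}_{μν}(x,y,z))] -/
def kernelPt (M : ℕ) (g : ∀ X : Finset (Pt d), Pt d → (Fin d × ↥(sites M X) → ℂ) → ℂ) :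
    Fin d → Fin d → Pt d → Pt d → Pt d → ℝ :=
  fun μ ν x y z => threeKernel M (kernelOf M (fun X => g X z)) μ ν x y z

/-! ## §4. Two-bond probes: the whole-lattice kernel is the second derivative of the whole-lattice density -/

/-- The two-bond probe configuration `w₀δ_{b₁} + w₁δ_{b₂}` (the directions `δ/δB_μ(x)`, `δ/δB_ν(y)` of (3.50)).
[cite: Balaban1988Convergent, (3.50) p.280] -/
def probe (b₁ b₂ : Fin d × Pt d) (w : Fin 2 → ℂ) : Fin d × Pt d → ℂ :=
  fun p => (if p = b₁ then w 0 else 0) + (if p = b₂ then w 1 else 0)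

/-- Translating the probe translates its bonds: `probe_{(μ,x+a),(ν,y+a)} w = τ_a(probe_{(μ,x),(ν,y)} w)`.
[cite: Balaban1988Convergent, (3.58) p.282] -/
theorem probe_shift (μ ν : Fin d) (x y a : Pt d) (w : Fin 2 → ℂ) :
    probe (μ, x + a) (ν, y + a) w = shift a (probe (μ, x) (ν, y) w) := by
  funext p
  rcases p with ⟨l, q⟩
  simp only [probe, shift, Prod.mk.injEq, sub_eq_iff_eq_add]

/-- The probe is a regular configuration: `sup|probe w| ≤ |w₀| + |w₁|`. [cite: Balaban1988Convergent, (3.50) p.280] -/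
theorem norm_probe_le (b₁ b₂ : Fin d × Pt d) (w : Fin 2 → ℂ) (p : Fin d × Pt d) :
    ‖probe b₁ b₂ w p‖ ≤ ‖w 0‖ + ‖w 1‖ := by
  unfold probe
  refine (norm_add_le _ _).trans (add_le_add ?_ ?_) <;> split_ifs <;> simp

variable {M : ℕ} {g : ∀ X : Finset (Pt d), Pt d → (Fin d × ↥(sites M X) → ℂ) → ℂ}

/-- The density probed along two bonds: `w ↦ 𝐄^{(j)}(U_j(exp i·probe_{b₁,b₂} w), z)`.
[cite: Balaban1988Convergent, (3.50) p.280, p.281] -/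
def probeFn (M : ℕ) (g : ∀ X : Finset (Pt d), Pt d → (Fin d × ↥(sites M X) → ℂ) → ℂ) (z : Pt d)
    (b₁ b₂ : Fin d × Pt d) : (Fin 2 → ℂ) → ℂ :=
  fun w => density M g z (probe b₁ b₂ w)

/-- The term of the probed density above the domain `X`. [cite: Balaban1988Convergent, (2.27) p.259] -/
def probeTerm (M : ℕ) (g : ∀ X : Finset (Pt d), Pt d → (Fin d × ↥(sites M X) → ℂ) → ℂ) (z : Pt d)
    (b₁ b₂ : Fin d × Pt d) (X : LocDom d) : (Fin 2 → ℂ) → ℂ :=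
  fun w => if coarse M z ∈ X.1 then g X.1 z (restr M X.1 (probe b₁ b₂ w)) else 0

/-- The probed density is the series of its terms. [cite: Balaban1988Convergent, (2.27) p.259] -/
theorem probeFn_eq_tsum (z : Pt d) (b₁ b₂ : Fin d × Pt d) :
    probeFn M g z b₁ b₂ = fun w => ∑' X : LocDom d, probeTerm M g z b₁ b₂ X w := rfl

/-- The restricted probe lies in the closed polydisc of radius `|w₀| + |w₁|`.
[cite: Balaban1988Convergent, (2.27)(ii) p.259] -/
theorem restr_probe_mem_polydisc (X : Finset (Pt d)) (b₁ b₂ : Fin d × Pt d) (w : Fin 2 → ℂ) {R : ℝ}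
    (hw : ‖w 0‖ + ‖w 1‖ ≤ R) : restr M X (probe b₁ b₂ w) ∈ polydisc (fun _ : Fin d × ↥(sites M X) => R) :=
  fun _ => (norm_probe_le b₁ b₂ w _).trans hw

/-- The restricted probe is analytic (indeed linear) in `w`. [cite: Balaban1988Convergent, (2.27)(ii) p.259] -/
theorem analyticAt_restr_probe (X : Finset (Pt d)) (b₁ b₂ : Fin d × Pt d) (w : Fin 2 → ℂ) :
    AnalyticAt ℂ (fun w' : Fin 2 → ℂ => restr M X (probe b₁ b₂ w')) w := by
  refine AnalyticAt.pi fun p => ?_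
  show AnalyticAt ℂ (fun w' : Fin 2 → ℂ => (if (p.1, (p.2 : Pt d)) = b₁ then w' 0 else 0)
    + (if (p.1, (p.2 : Pt d)) = b₂ then w' 1 else 0)) w
  refine AnalyticAt.add ?_ ?_
  · split_ifs
    · exact (ContinuousLinearMap.proj (R := ℂ) (φ := fun _ : Fin 2 => ℂ) 0).analyticAt w
    · exact analyticAt_const
  · split_ifs
    · exact (ContinuousLinearMap.proj (R := ℂ) (φ := fun _ : Fin 2 => ℂ) 1).analyticAt w
    · exact analyticAt_const

/-- The open sup-ball of radius `R/2` in the probe variables. [cite: Balaban1988Convergent, (2.27)(ii) p.259] -/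
def halfBall (R : ℝ) : Set (Fin 2 → ℂ) := {w | ∀ i, ‖w i‖ < R / 2}

omit d in
/-- The sup-ball is open. [cite: Balaban1988Convergent, (2.27)(ii) p.259] -/
theorem isOpen_halfBall (R : ℝ) : IsOpen (halfBall R) := by
  have : halfBall R = ⋂ i : Fin 2, (fun w : Fin 2 → ℂ => w i) ⁻¹' ball (0 : ℂ) (R / 2) := by
    ext w
    simp [halfBall, Set.mem_iInter]
  rw [this]
  exact isOpen_iInter_of_finite fun i => (continuous_apply i).isOpen_preimage _ isOpen_ball

omit d in
/-- On the sup-ball of radius `R/2` the probe has `|w₀| + |w₁| < R`. [cite: Balaban1988Convergent, (2.27)(ii) p.259] -/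
theorem norm_add_lt_of_mem_halfBall {R : ℝ} {w : Fin 2 → ℂ} (hw : w ∈ halfBall R) : ‖w 0‖ + ‖w 1‖ < R := by
  have h0 := hw 0
  have h1 := hw 1
  linarith

omit d in
/-- The closed polydisc of radius `R/4` lies in the sup-ball of radius `R/2` (`R > 0`).
[cite: Balaban1988Convergent, (2.27)(ii) p.259] -/
theorem polydisc_quarter_subset_halfBall {R : ℝ} (hR : 0 < R) :
    polydisc (fun _ : Fin 2 => R / 4) ⊆ halfBall R := fun w hw i => by
  have := hw i
  simp only at this
  show ‖w i‖ < R / 2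
  linarith

/-- Every term of the probed density is analytic on the sup-ball of radius `R/2`, when `g X z` is analytic on an open
set containing the closed polydisc of radius `R` ((2.27)(ii)). [cite: Balaban1988Convergent, (2.27)(ii) p.259] -/
theorem analyticOnNhd_probeTerm {U : ∀ X : Finset (Pt d), Set (Fin d × ↥(sites M X) → ℂ)}
    (hg : ∀ X z, AnalyticOnNhd ℂ (g X z) (U X)) {R : ℝ} (hRU : ∀ X, polydisc (fun _ => R) ⊆ U X)
    (z : Pt d) (b₁ b₂ : Fin d × Pt d) (X : LocDom d) :
    AnalyticOnNhd ℂ (probeTerm M g z b₁ b₂ X) (halfBall R) := by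
  intro w hw
  unfold probeTerm
  by_cases hz : coarse M z ∈ X.1
  · simp only [hz, if_true]
    have hmem : restr M X.1 (probe b₁ b₂ w) ∈ U X.1 :=
      hRU X.1 (restr_probe_mem_polydisc X.1 b₁ b₂ w (norm_add_lt_of_mem_halfBall hw).le)
    exact AnalyticAt.comp (g := g X.1 z) (f := fun w' : Fin 2 → ℂ => restr M X.1 (probe b₁ b₂ w')) (hg X.1 z _ hmem)
      (analyticAt_restr_probe X.1 b₁ b₂ w)
  · simp only [hz, if_false]
    exact analyticAt_const

/-- The (2.27)(iv) majorant of the terms on the polydisc of radius `R/4`: `‖term_X(w)‖ ≤ E₀·e^{−κd_j(X)}·[X ∋ cube z]`.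
[cite: Balaban1988Convergent, (2.27)(iv) p.259] -/
theorem norm_probeTerm_le {R E₀ κ : ℝ} (hR : 0 < R)
    (hA : ∀ (X : LocDom d) (z : Pt d), ∀ s ∈ polydisc (fun _ : Fin d × ↥(sites M X.1) => R),
      ‖g X.1 z s‖ ≤ E₀ * Real.exp (-κ * treeLen X.1))
    (z : Pt d) (b₁ b₂ : Fin d × Pt d) (X : LocDom d) (w : Fin 2 → ℂ)
    (hw : w ∈ polydisc (fun _ : Fin 2 => R / 4)) :
    ‖probeTerm M g z b₁ b₂ X w‖ ≤ E₀ * expAbove κ (coarse M z) X := by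
  unfold probeTerm expAbove
  by_cases hz : coarse M z ∈ X.1
  · simp only [hz, if_true]
    have h0 := hw 0
    have h1 := hw 1
    simp only at h0 h1
    exact hA X z _ (restr_probe_mem_polydisc X.1 b₁ b₂ w (by linarith))
  · simp only [hz, if_false, norm_zero, mul_zero]
    exact le_rfl

/-- **The series of the second derivatives converges to the second derivative of the series**, for the probed density:
`Σ_X ∂₀∂₁ term_X(0) = ∂₀∂₁ [w ↦ 𝐄^{(j)}(U_j(exp i·probe w), z)](0)` — §2 with the (2.27)(iv) majorant and [II] (1.26)
on the infinite lattice (`summable_expAbove`, `κ ≥ κ₀(4·2^d, 2d)`).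
[cite: Balaban1988Convergent, p.281 (Π given by (3.50) with 𝐄^{(j)}(X,U_j,z) replaced by 𝐄^{(j)}(U_j,z))] -/
theorem hasSum_pderiv_pderiv_probeTerm {U : ∀ X : Finset (Pt d), Set (Fin d × ↥(sites M X) → ℂ)}
    (hg : ∀ X z, AnalyticOnNhd ℂ (g X z) (U X)) {R E₀ κ : ℝ} (hR : 0 < R)
    (hRU : ∀ X, polydisc (fun _ => R) ⊆ U X)
    (hA : ∀ (X : LocDom d) (z : Pt d), ∀ s ∈ polydisc (fun _ : Fin d × ↥(sites M X.1) => R),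
      ‖g X.1 z s‖ ≤ E₀ * Real.exp (-κ * treeLen X.1))
    (hκ : kappa₀ (4 * 2 ^ d) (2 * d) ≤ κ) (z : Pt d) (b₁ b₂ : Fin d × Pt d) :
    HasSum (fun X : LocDom d => pderiv 0 (pderiv 1 (probeTerm M g z b₁ b₂ X)) 0)
      (pderiv 0 (pderiv 1 (probeFn M g z b₁ b₂)) 0) := by
  rw [probeFn_eq_tsum]
  exact hasSum_pderiv_pderiv (isOpen_halfBall R) (analyticOnNhd_probeTerm hg hRU z b₁ b₂) (by linarith)
    (polydisc_quarter_subset_halfBall hR) ((summable_expAbove hκ (coarse M z)).mul_left E₀)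
    (fun X w hw => norm_probeTerm_le hR hA z b₁ b₂ X w hw) 0 1

/-- Identification of a bond over the sites of `X` with a whole-lattice bond. [cite: Balaban1988Convergent, (2.27)(i) p.259] -/
theorem eq_mk_iff {X : Finset (Pt d)} (q : Fin d × ↥(sites M X)) (μ : Fin d) (x : Pt d) (hx : x ∈ sites M X) :
    q = (μ, (⟨x, hx⟩ : ↥(sites M X))) ↔ (q.1, (q.2 : Pt d)) = (μ, x) := by
  constructor
  · rintro rfl
    rfl
  · intro h
    simp only [Prod.mk.injEq] at h
    exact Prod.ext h.1 (Subtype.ext h.2)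

/-- When both probed bonds have their sites in the cubes of `X`, the restricted probe is the span map of the two
coordinate vectors: `(probe w)↾X = w₀e_{(μ,x)} + w₁e_{(ν,y)}`. [cite: Balaban1988Convergent, (3.50) p.280] -/
theorem restr_probe_eq_lin {X : Finset (Pt d)} {μ ν : Fin d} {x y : Pt d} (hx : x ∈ sites M X) (hy : y ∈ sites M X)
    (w : Fin 2 → ℂ) :
    restr M X (probe (μ, x) (ν, y) w)
      = lin (![(μ, (⟨x, hx⟩ : ↥(sites M X))), (ν, (⟨y, hy⟩ : ↥(sites M X)))]) w := by
  funext q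
  simp only [restr, probe, lin, Fin.sum_univ_two, Matrix.cons_val_zero, Matrix.cons_val_one, Pi.add_apply,
    Pi.smul_apply, Pi.single_apply, smul_eq_mul, mul_ite, mul_one, mul_zero]
  exact congrArg₂ (· + ·) (if_congr (eq_mk_iff q μ x hx).symm rfl rfl) (if_congr (eq_mk_iff q ν y hy).symm rfl rfl)

/-- If the site of the second probed bond is not in the cubes of `X`, the term above `X` does not depend on `w₁`.
[cite: Balaban1988Convergent, (2.27)(i) p.259] -/
theorem probeTerm_update_one {z : Pt d} {μ ν : Fin d} {x y : Pt d} {X : LocDom d} (hy : y ∉ sites M X.1)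
    (w : Fin 2 → ℂ) (t : ℂ) : probeTerm M g z (μ, x) (ν, y) X (update w 1 t) = probeTerm M g z (μ, x) (ν, y) X w := by
  unfold probeTerm
  split_ifs with hz
  · congr 1
    funext q
    have hq : (q.1, (q.2 : Pt d)) ≠ (ν, y) := fun h => hy (by
      rw [Prod.mk.injEq] at h
      rw [← h.2]
      exact q.2.2)
    simp [restr, probe, hq]
  · rfl

/-- If the site of the first probed bond is not in the cubes of `X`, the term above `X` does not depend on `w₀`.
[cite: Balaban1988Convergent, (2.27)(i) p.259] -/
theorem probeTerm_update_zero {z : Pt d} {μ ν : Fin d} {x y : Pt d} {X : LocDom d} (hx : x ∉ sites M X.1)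
    (w : Fin 2 → ℂ) (t : ℂ) : probeTerm M g z (μ, x) (ν, y) X (update w 0 t) = probeTerm M g z (μ, x) (ν, y) X w := by
  unfold probeTerm
  split_ifs with hz
  · congr 1
    funext q
    have hq : (q.1, (q.2 : Pt d)) ≠ (μ, x) := fun h => hx (by
      rw [Prod.mk.injEq] at h
      rw [← h.2]
      exact q.2.2)
    simp [restr, probe, hq]
  · rfl

/-- **Termwise identification**: the `X`-term of the whole-lattice kernel at `z` is `Re ∂₀∂₁ term_X(0)` — the (3.50)
kernel `kernelOf` of `g X z` read through the two-bond probe (pull-back along the coordinate vectors when both sites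
are in the cubes of `X`; zero otherwise, on both sides). [cite: Balaban1988Convergent, (3.50) p.280] -/
theorem term_eq_re_pderiv_probeTerm (z : Pt d) (μ ν : Fin d) (x y : Pt d) (X : LocDom d) :
    (if coarse M z ∈ X.1 then kernelOf M (fun X => g X z) X.1 μ ν x y else 0)
      = (pderiv 0 (pderiv 1 (probeTerm M g z (μ, x) (ν, y) X)) 0).re := by
  by_cases hz : coarse M z ∈ X.1
  · rw [if_pos hz]
    unfold kernelOf
    by_cases hxy : x ∈ sites M X.1 ∧ y ∈ sites M X.1
    · rw [dif_pos hxy]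
      have hfun : probeTerm M g z (μ, x) (ν, y) X
          = fun w => g X.1 z (lin (![(μ, (⟨x, hxy.1⟩ : ↥(sites M X.1))), (ν, (⟨y, hxy.2⟩ : ↥(sites M X.1)))]) w) := by
        funext w
        simp only [probeTerm, hz, if_true, restr_probe_eq_lin hxy.1 hxy.2]
      rw [hfun]
      have h1 : pderiv 1 (fun w => g X.1 z (lin (![(μ, (⟨x, hxy.1⟩ : ↥(sites M X.1))),
          (ν, (⟨y, hxy.2⟩ : ↥(sites M X.1)))]) w))
          = fun w => pderiv (ν, (⟨y, hxy.2⟩ : ↥(sites M X.1))) (g X.1 z)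
              (lin (![(μ, (⟨x, hxy.1⟩ : ↥(sites M X.1))), (ν, (⟨y, hxy.2⟩ : ↥(sites M X.1)))]) w) := by
        funext w
        rw [pderiv_comp_lin]
        rfl
      rw [h1, pderiv_comp_lin]
      simp [lin]
    · rw [dif_neg hxy]
      rw [not_and_or] at hxy
      rcases hxy with hx | hy
      · have hind : ∀ v t, probeTerm M g z (μ, x) (ν, y) X (update v 0 t) = probeTerm M g z (μ, x) (ν, y) X v :=
          fun v t => probeTerm_update_zero hx v t
        rw [show pderiv 0 (pderiv 1 (probeTerm M g z (μ, x) (ν, y) X)) 0 = 0 from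
          pderiv_eq_zero_of_forall_update (fun v t => pderiv_update_of_forall_update hind 1 v t) 0]
        simp
      · have hind : ∀ v t, probeTerm M g z (μ, x) (ν, y) X (update v 1 t) = probeTerm M g z (μ, x) (ν, y) X v :=
          fun v t => probeTerm_update_one hy v t
        have h1 : pderiv 1 (probeTerm M g z (μ, x) (ν, y) X) = fun _ => 0 :=
          funext fun v => pderiv_eq_zero_of_forall_update hind v
        rw [h1]
        simp [pderiv]
  · rw [if_neg hz]
    have h0 : probeTerm M g z (μ, x) (ν, y) X = fun _ => 0 := by
      funext w
      simp [probeTerm, hz]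
    rw [h0]
    simp [pderiv]

/-- **THE WHOLE-LATTICE KERNEL IS THE SECOND DERIVATIVE OF THE WHOLE-LATTICE DENSITY**: for a pointed analytic localized
family ((2.27)(i), (ii), (iv), `κ ≥ κ₀(4·2^d, 2d)`), `Π^{(j)}_{μν}(x, y, z) = Re ∂₀∂₁ [w ↦ 𝐄^{(j)}(U_j(exp i(w₀δ_{(μ,x)} +
w₁δ_{(ν,y)})), z)](0)` — *"(3.50), but with 𝐄^{(j)}(X, U_j, z) replaced by 𝐄^{(j)}(U_j, z)"*, the termwise definition
(`B14.Eq357KernelDecay` (M1″)) reconciled with the printed one.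
[cite: Balaban1988Convergent, (3.50) p.280, p.281 (the function Π^{(j)}_{μν}(x,y,z))] -/
theorem kernelPt_eq_re_pderiv {U : ∀ X : Finset (Pt d), Set (Fin d × ↥(sites M X) → ℂ)}
    (hg : ∀ X z, AnalyticOnNhd ℂ (g X z) (U X)) {R E₀ κ : ℝ} (hR : 0 < R)
    (hRU : ∀ X, polydisc (fun _ => R) ⊆ U X)
    (hA : ∀ (X : LocDom d) (z : Pt d), ∀ s ∈ polydisc (fun _ : Fin d × ↥(sites M X.1) => R),
      ‖g X.1 z s‖ ≤ E₀ * Real.exp (-κ * treeLen X.1))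
    (hκ : kappa₀ (4 * 2 ^ d) (2 * d) ≤ κ) (μ ν : Fin d) (x y z : Pt d) :
    kernelPt M g μ ν x y z = (pderiv 0 (pderiv 1 (probeFn M g z (μ, x) (ν, y))) 0).re := by
  have hs := hasSum_pderiv_pderiv_probeTerm hg hR hRU hA hκ z (μ, x) (ν, y)
  rw [← hs.tsum_eq, Complex.re_tsum hs.summable]
  unfold kernelPt threeKernel
  exact tsum_congr fun X => term_eq_re_pderiv_probeTerm z μ ν x y X

/-! ## §5. Translation invariance from (3.58); `Π_{μν,κλ}` independent of `z`; (3.64) -/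

/-- (3.58) for translations makes the probed densities at `(z; (μ,x), (ν,y))` and at `(z+a; (μ,x+a), (ν,y+a))` the SAME
function on the sup-ball of radius `R/2`. [cite: Balaban1988Convergent, (3.58) p.282] -/
theorem probeFn_shift_eqOn {R : ℝ} (h358 : Eq358Transl M g R) (z a : Pt d) (μ ν : Fin d) (x y : Pt d) :
    Set.EqOn (probeFn M g (z + a) (μ, x + a) (ν, y + a)) (probeFn M g z (μ, x) (ν, y)) (halfBall R) := by
  intro w hw
  unfold probeFn
  rw [probe_shift]
  exact h358 a z _ fun p => (norm_probe_le _ _ w p).trans_lt (norm_add_lt_of_mem_halfBall hw)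

/-- **p. 281: "This function is translation invariant"** — PROVED from (3.58) for translations: the whole-lattice
three-point kernel of a pointed analytic localized family ((2.27)(i), (ii), (iv), `κ ≥ κ₀(4·2^d, 2d)`) satisfies
`Π^{(j)}_{μν}(x + a, y + a, z + a) = Π^{(j)}_{μν}(x, y, z)` — the hypothesis `TranslInv` of `B14.Eq364Beta.eq364` /
`Eq362Marginals.eq364_of_WT` DISCHARGED to print's (2.29)/(3.58). [cite: Balaban1988Convergent, p.281 (This function is translation invariant), (3.58) p.282] -/
theorem translInv_kernelPt {U : ∀ X : Finset (Pt d), Set (Fin d × ↥(sites M X) → ℂ)}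
    (hg : ∀ X z, AnalyticOnNhd ℂ (g X z) (U X)) {R E₀ κ : ℝ} (hR : 0 < R)
    (hRU : ∀ X, polydisc (fun _ => R) ⊆ U X)
    (hA : ∀ (X : LocDom d) (z : Pt d), ∀ s ∈ polydisc (fun _ : Fin d × ↥(sites M X.1) => R),
      ‖g X.1 z s‖ ≤ E₀ * Real.exp (-κ * treeLen X.1))
    (hκ : kappa₀ (4 * 2 ^ d) (2 * d) ≤ κ) (h358 : Eq358Transl M g R) : TranslInv (kernelPt M g) := by
  intro μ ν x y z a
  rw [kernelPt_eq_re_pderiv hg hR hRU hA hκ μ ν (x + a) (y + a) (z + a),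
    kernelPt_eq_re_pderiv hg hR hRU hA hκ μ ν x y z]
  congr 1
  have hopen := isOpen_halfBall R
  have h0 : (0 : Fin 2 → ℂ) ∈ halfBall R := fun i => by
    simp only [Pi.zero_apply, norm_zero]
    linarith
  have heq : Set.EqOn (pderiv 1 (probeFn M g (z + a) (μ, x + a) (ν, y + a)))
      (pderiv 1 (probeFn M g z (μ, x) (ν, y))) (halfBall R) := fun v hv =>
    pderiv_congr_of_eqOn hopen (probeFn_shift_eqOn h358 z a μ ν x y) 1 hv
  exact pderiv_congr_of_eqOn hopen heq 0 h0

/-- The second moment of the three-point kernel AT THE POINT `z`: `Π^{(j)}_{μν,κλ}(z) := Σ_{x,y} Π^{(j)}_{μν}(x, y, z)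
(x_κ − z_κ)(y_λ − z_λ)` (p. 281), as one sum over `Z^d × Z^d`; `B14Eq360TensorInvariance.P4` is its value at `z = 0`.
[cite: Balaban1988Convergent, p.281 (Π^{(j)}_{μν,κλ})] -/
def P4At (P3 : Fin d → Fin d → Pt d → Pt d → Pt d → ℝ) (μ ν κ' τ : Fin d) (z : Pt d) : ℝ :=
  ∑' q : Pt d × Pt d, P3 μ ν q.1 q.2 z * (((q.1 κ' : ℝ) - (z κ' : ℝ)) * ((q.2 τ : ℝ) - (z τ : ℝ)))

/-- **p. 281: "hence Π^{(j)}_{μν,κλ} is independent of z"** — for a translation invariant three-point kernel the moment at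
`z` equals the moment at `0` (re-indexing `(x, y) ↦ (x + z, y + z)`). [cite: Balaban1988Convergent, p.281 (Π^{(j)}_{μν,κλ} is independent of z)] -/
theorem P4At_eq_P4 {P3 : Fin d → Fin d → Pt d → Pt d → Pt d → ℝ} (hT : TranslInv P3) (μ ν κ' τ : Fin d)
    (z : Pt d) : P4At P3 μ ν κ' τ z = P4 P3 μ ν κ' τ := by
  unfold P4At P4
  let e : Pt d × Pt d ≃ Pt d × Pt d :=
    { toFun := fun q => (q.1 + z, q.2 + z)
      invFun := fun q => (q.1 - z, q.2 - z)
      left_inv := fun q => by simp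
      right_inv := fun q => by simp }
  rw [← e.tsum_eq]
  refine tsum_congr fun q => ?_
  have h := hT μ ν q.1 q.2 0 z
  rw [zero_add] at h
  show P3 μ ν (q.1 + z) (q.2 + z) z * (((((q.1 + z) κ' : ℤ) : ℝ) - (z κ' : ℝ)) * ((((q.2 + z) τ : ℤ) : ℝ) - (z τ : ℝ)))
    = P3 μ ν q.1 q.2 0 * ((q.1 κ' : ℝ) * (q.2 τ : ℝ))
  rw [h]
  simp only [Pi.add_apply, Int.cast_add, add_sub_cancel_right]

/-- `Π^{(j)}_{μν,κλ}` of the whole-lattice kernel of a pointed analytic localized family does not depend on `z`, given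
(3.58) for translations. [cite: Balaban1988Convergent, p.281 (Π^{(j)}_{μν,κλ} is independent of z)] -/
theorem P4At_kernelPt_eq {U : ∀ X : Finset (Pt d), Set (Fin d × ↥(sites M X) → ℂ)}
    (hg : ∀ X z, AnalyticOnNhd ℂ (g X z) (U X)) {R E₀ κ : ℝ} (hR : 0 < R)
    (hRU : ∀ X, polydisc (fun _ => R) ⊆ U X)
    (hA : ∀ (X : LocDom d) (z : Pt d), ∀ s ∈ polydisc (fun _ : Fin d × ↥(sites M X.1) => R),
      ‖g X.1 z s‖ ≤ E₀ * Real.exp (-κ * treeLen X.1))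
    (hκ : kappa₀ (4 * 2 ^ d) (2 * d) ≤ κ) (h358 : Eq358Transl M g R) (μ ν κ' τ : Fin d) (z : Pt d) :
    P4At (kernelPt M g) μ ν κ' τ z = P4 (kernelPt M g) μ ν κ' τ :=
  P4At_eq_P4 (translInv_kernelPt hg hR hRU hA hκ h358) μ ν κ' τ z

/-- **`β′_j = β_j` ((3.61)–(3.64)) for the whole-lattice kernel of a pointed analytic localized family, `TranslInv`
DISCHARGED** — `B14.Eq362Marginals.eq364_of_WT` fed with: translation invariance from (3.58) for translations
(`translInv_kernelPt`); `Decay3` from (2.27)(i), (ii), (iv) (`B14.Eq350KernelCauchy.decay3_kernelOf` at each `z`); the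
(I.4.15)₁ identities at `z = 0` from linearized (2.27)(iii) (`wardY_kernelOf`/`wardX_kernelOf` and
`B14.Eq362KernelWard.wardY_threeKernel`/`wardX_threeKernel`).  Remaining inputs: the per-domain data (2.27)(i)–(iv), (3.58)
for translations, and [I]'s Taylor data (I.5.16) of the summed kernel (3.63).
[cite: Balaban1988Convergent, (3.64) p.283] -/
theorem eq364_kernelPt (hM : 0 < M) (hd : 0 < d) {U : ∀ X : Finset (Pt d), Set (Fin d × ↥(sites M X) → ℂ)}
    (hU : ∀ X, IsOpen (U X)) (hg : ∀ X z, AnalyticOnNhd ℂ (g X z) (U X)) {R E₀ κ : ℝ} (hR : 0 < R) (hE₀ : 0 ≤ E₀)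
    (hRU : ∀ X, polydisc (fun _ => R) ⊆ U X)
    (hA : ∀ (X : LocDom d) (z : Pt d), ∀ s ∈ polydisc (fun _ : Fin d × ↥(sites M X.1) => R),
      ‖g X.1 z s‖ ≤ E₀ * Real.exp (-κ * treeLen X.1))
    (hκ : kappa₀ (4 * 2 ^ d) (2 * d) ≤ κ / 3) (hκ0 : 0 < κ)
    (hginv : ∀ (X : Finset (Pt d)) (z : Pt d) (lam : Pt d → ℝ), ∀ᶠ B in 𝓝 (0 : Fin d × ↥(sites M X) → ℂ),
      ∀ᶠ t in 𝓝 (0 : ℂ), g X z (B + t • gaugeDir M X lam) = g X z B)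
    (h358 : Eq358Transl M g R) {one two : Fin d} (h12 : two ≠ one) {β : ℝ}
    (hTD : ∀ μ ν, B12Rep537.TaylorData3 (β : ℂ) μ ν
      (B12Form543.ofRealK (Eq363SummedKernel.sumKernel (kernelPt M g)) μ ν)) :
    betaPrime (kernelPt M g) one two = β := by
  have hκ' : kappa₀ (4 * 2 ^ d) (2 * d) ≤ κ := hκ.trans (by linarith)
  have h0 : ∀ X, (0 : Fin d × ↥(sites M X) → ℂ) ∈ U X := fun X => hRU X (zero_mem_polydisc fun _ => hR.le)
  have hE₂ : 0 ≤ 4 * E₀ / R ^ 2 := div_nonneg (mul_nonneg (by norm_num) hE₀) (pow_nonneg hR.le 2)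
  -- the per-`z` data of the family `X ↦ g X z`
  have hloc : ∀ z X μ ν x y, kernelOf M (fun X => g X z) X μ ν x y ≠ 0 → coarse M x ∈ X ∧ coarse M y ∈ X :=
    fun z X μ ν x y h => kernelOf_loc hM X μ ν x y h
  have hbd : ∀ z, ∀ X : LocDom d, ∀ μ ν x y,
      |kernelOf M (fun X => g X z) X.1 μ ν x y| ≤ 4 * E₀ / R ^ 2 * Real.exp (-κ * treeLen X.1) :=
    fun z => kernelOf_bound (g := fun X => g X z) hU (fun X => hg X z) hR hE₀ hRU (fun X s hs => hA X z s hs)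
  have hT : TranslInv (kernelPt M g) := translInv_kernelPt hg hR hRU hA hκ' h358
  have hD : Decay3 (kernelPt M g) (4 * E₀ / R ^ 2 * K₀ (4 * 2 ^ d) (2 * d) * Real.exp (4 * κ / 3))
      (κ / (3 * d * M)) := fun μ ν x y z =>
    decay3_threeKernel hM hE₂ hκ hκ0.le (hloc z) (hbd z) μ ν x y z
  have hr : 0 < κ / (3 * d * M) := div_pos hκ0 (by positivity)
  have hWT : ∀ (μ : Fin d) (x : Pt d) (lam : Pt d → ℝ), (Function.support lam).Finite →
      ∑' y : Pt d, ∑ ν, kernelPt M g μ ν x y 0 * grad lam ν y = 0 := fun μ x lam hlam =>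
    wardY_threeKernel hM hE₂ hκ hκ0.le (hloc 0) (hbd 0)
      (fun X μ' x' lam' _ => wardY_kernelOf hU h0 (fun X => hg X 0) (fun X lam'' => hginv X 0 lam'') X.1 μ' x' lam')
      0 μ x lam hlam
  have hWT' : ∀ (ν : Fin d) (y : Pt d) (lam : Pt d → ℝ), (Function.support lam).Finite →
      ∑' x : Pt d, ∑ μ, kernelPt M g μ ν x y 0 * grad lam μ x = 0 := fun ν y lam hlam =>
    wardX_threeKernel hM hE₂ hκ hκ0.le (hloc 0) (hbd 0)
      (fun X ν' y' lam' _ => wardX_kernelOf hU h0 (fun X => hg X 0) (fun X lam'' => hginv X 0 lam'') X.1 ν' y' lam')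
      0 ν y lam hlam
  exact Eq362Marginals.eq364_of_WT hT hD hr h12 hWT hWT' hTD

/-! ## §6. (v1.1) (3.58) for axis reflections and permutations ⇒ (3.59) for the whole-lattice kernel ⇒ (3.60)/(3.61) -/

section Diag

variable {κι : Type*} [Fintype κι] [DecidableEq κι] {F : Type*} [NormedAddCommGroup F] [NormedSpace ℂ F]

omit [Fintype κι] in
/-- Slice derivatives under a diagonal rescaling of the coordinates: `∂_i (Φ ∘ diag c)(w) = c_i·(∂_i Φ)(diag c·w)`.
[cite: Balaban1988Convergent, (3.59) p.282] -/
theorem pderiv_comp_diag (c : κι → ℂ) (Φ : (κι → ℂ) → F) (w : κι → ℂ) (i : κι) :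
    pderiv i (fun w' : κι → ℂ => Φ (fun j => c j * w' j)) w = c i • pderiv i Φ (fun j => c j * w j) := by
  unfold pderiv
  have h : (fun t : ℂ => Φ (fun j => c j * update w i t j))
      = fun t : ℂ => (fun r : ℂ => Φ (update (fun j => c j * w j) i r)) (c i * t) := by
    funext t
    congr 1
    funext j
    by_cases hj : j = i
    · subst hj
      simp
    · simp [update_of_ne hj]
  rw [h]
  have key := deriv_comp_mul_left (c i) (fun r : ℂ => Φ (update (fun j => c j * w j) i r)) (w i)
  exact key

end Diag

/-- The reflected point `r_αz = (…, −z_α, …)` (the site map of the reflection in the hyperplane `x_α = 0`).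
[cite: Balaban1988Convergent, (3.58) p.282] -/
def reflPt (α : Fin d) (z : Pt d) : Pt d := fun i => if i = α then -z i else z i

/-- `r_α 0 = 0`. [cite: Balaban1988Convergent, (3.58) p.282] -/
theorem reflPt_zero (α : Fin d) : reflPt α (0 : Pt d) = 0 := by
  funext i
  simp [reflPt]

/-- **The reflected configuration** `(rB)_μ(x) = s_α(μ)·B_μ(r_{α,μ}x)` for the reflection `r = r_α` (p. 282: *"if r is the
reflection in the hyperplane x_μ = 0, then (rB)_μ(x) = −B_μ((…, −x_μ − 1, …))"*; `r_{α,μ}` = `Eq360TensorInvariance.reflSrc`,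
`s_α` = `B14Sect3.axisSign`). [cite: Balaban1988Convergent, (3.58) p.282] -/
def reflCfg (α : Fin d) (B : Fin d × Pt d → ℂ) : Fin d × Pt d → ℂ :=
  fun p => (B14Sect3.axisSign α p.1 : ℂ) * B (p.1, Eq360TensorInvariance.reflSrc α p.1 p.2)

/-- **The permuted configuration** `(σB)_{μ'}(x') = B_{σ⁻¹μ'}(σ⁻¹x')` for a coordinate permutation `σ` (`σe_κ = e_{σκ}`,
`Eq360TensorInvariance.permPt`). [cite: Balaban1988Convergent, (3.58)–(3.59) p.282] -/
def permCfg (σ : Equiv.Perm (Fin d)) (B : Fin d × Pt d → ℂ) : Fin d × Pt d → ℂ :=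
  fun p => B (σ.symm p.1, Eq360TensorInvariance.permPt σ.symm p.2)

/-- **(3.58) for the axis reflections** `r_α`: `𝐄^{(j)}(U_j(exp irB), rz) = 𝐄^{(j)}(U_j(exp iB), z)` on the regular
configurations `sup|B_μ(x)| < R`. [cite: Balaban1988Convergent, (3.58) p.282] -/
def Eq358Refl (M : ℕ) (g : ∀ X : Finset (Pt d), Pt d → (Fin d × ↥(sites M X) → ℂ) → ℂ) (R : ℝ) : Prop :=
  ∀ (α : Fin d) (z : Pt d) (B : Fin d × Pt d → ℂ), (∀ p, ‖B p‖ < R) →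
    density M g (reflPt α z) (reflCfg α B) = density M g z B

/-- **(3.58) for the coordinate permutations** `σ`: `𝐄^{(j)}(U_j(exp iσB), σz) = 𝐄^{(j)}(U_j(exp iB), z)` on the regular
configurations. [cite: Balaban1988Convergent, (3.58) p.282] -/
def Eq358Perm (M : ℕ) (g : ∀ X : Finset (Pt d), Pt d → (Fin d × ↥(sites M X) → ℂ) → ℂ) (R : ℝ) : Prop :=
  ∀ (σ : Equiv.Perm (Fin d)) (z : Pt d) (B : Fin d × Pt d → ℂ), (∀ p, ‖B p‖ < R) →
    density M g (Eq360TensorInvariance.permPt σ z) (permCfg σ B) = density M g z B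

/-- The sign-twist of the probe variables under `r_α`: `(w₀, w₁) ↦ (s_α(μ)w₀, s_α(ν)w₁)`.
[cite: Balaban1988Convergent, (3.58) p.282] -/
def twist (α μ ν : Fin d) : Fin 2 → ℂ := ![(B14Sect3.axisSign α μ : ℂ), (B14Sect3.axisSign α ν : ℂ)]

/-- `s_α(μ) ∈ {±1}` has norm one. [cite: Balaban1988Convergent, (3.58) p.282] -/
theorem norm_axisSign (α μ : Fin d) : ‖(B14Sect3.axisSign α μ : ℂ)‖ = 1 := by
  unfold B14Sect3.axisSign
  split_ifs <;> simp

/-- The twist has unit entries. [cite: Balaban1988Convergent, (3.58) p.282] -/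
theorem norm_twist (α μ ν : Fin d) (i : Fin 2) : ‖twist α μ ν i‖ = 1 := by
  fin_cases i
  · exact norm_axisSign α μ
  · exact norm_axisSign α ν

/-- **The reflected probe is the twisted probe at the reflected bonds**: `r_α(w₀δ_{(μ,x)} + w₁δ_{(ν,y)}) =
s_α(μ)w₀δ_{(μ,r_{α,μ}x)} + s_α(ν)w₁δ_{(ν,r_{α,ν}y)}`. [cite: Balaban1988Convergent, (3.58) p.282] -/
theorem reflCfg_probe (α μ ν : Fin d) (x y : Pt d) (w : Fin 2 → ℂ) :
    reflCfg α (probe (μ, x) (ν, y) w)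
      = probe (μ, Eq360TensorInvariance.reflSrc α μ x) (ν, Eq360TensorInvariance.reflSrc α ν y)
          (fun i => twist α μ ν i * w i) := by
  funext p
  rcases p with ⟨l, q⟩
  simp only [reflCfg, probe, twist, Prod.mk.injEq, Matrix.cons_val_zero, Matrix.cons_val_one, mul_add, mul_ite,
    mul_zero]
  congr 1
  · by_cases h : l = μ
    · subst h
      by_cases hq : Eq360TensorInvariance.reflSrc α l q = x
      · have hq' : q = Eq360TensorInvariance.reflSrc α l x := by
          rw [← hq, Eq360TensorInvariance.reflSrc_reflSrc]
        simp [hq', Eq360TensorInvariance.reflSrc_reflSrc]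
      · have hq' : q ≠ Eq360TensorInvariance.reflSrc α l x := fun h' =>
          hq (by rw [h', Eq360TensorInvariance.reflSrc_reflSrc])
        simp [hq, hq']
    · simp [h]
  · by_cases h : l = ν
    · subst h
      by_cases hq : Eq360TensorInvariance.reflSrc α l q = y
      · have hq' : q = Eq360TensorInvariance.reflSrc α l y := by
          rw [← hq, Eq360TensorInvariance.reflSrc_reflSrc]
        simp [hq', Eq360TensorInvariance.reflSrc_reflSrc]
      · have hq' : q ≠ Eq360TensorInvariance.reflSrc α l y := fun h' =>
          hq (by rw [h', Eq360TensorInvariance.reflSrc_reflSrc])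
        simp [hq, hq']
    · simp [h]

/-- **The permuted probe is the probe at the permuted bonds**: `σ(w₀δ_{(μ,x)} + w₁δ_{(ν,y)}) = w₀δ_{(σμ,σx)} + w₁δ_{(σν,σy)}`.
[cite: Balaban1988Convergent, (3.58) p.282] -/
theorem permCfg_probe (σ : Equiv.Perm (Fin d)) (μ ν : Fin d) (x y : Pt d) (w : Fin 2 → ℂ) :
    permCfg σ (probe (μ, x) (ν, y) w)
      = probe (σ μ, Eq360TensorInvariance.permPt σ x) (σ ν, Eq360TensorInvariance.permPt σ y) w := by
  funext p
  rcases p with ⟨l, q⟩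
  have key : ∀ (μ' : Fin d) (x' : Pt d), (σ.symm l = μ' ∧ Eq360TensorInvariance.permPt σ.symm q = x')
      ↔ (l = σ μ' ∧ q = Eq360TensorInvariance.permPt σ x') := by
    intro μ' x'
    rw [Equiv.symm_apply_eq]
    refine and_congr Iff.rfl ⟨fun h => ?_, fun h => ?_⟩
    · rw [← h]
      exact ((Eq360TensorInvariance.permPtEquiv σ).apply_symm_apply q).symm
    · rw [h]
      exact (Eq360TensorInvariance.permPtEquiv σ).symm_apply_apply x'
  simp only [permCfg, probe, Prod.mk.injEq]
  exact congrArg₂ (· + ·) (if_congr (key μ x) rfl rfl) (if_congr (key ν y) rfl rfl)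

/-- The reflection preserves regularity: `sup|rB| = sup|B|` bondwise. [cite: Balaban1988Convergent, (3.58) p.282] -/
theorem norm_reflCfg (α : Fin d) (B : Fin d × Pt d → ℂ) (p : Fin d × Pt d) :
    ‖reflCfg α B p‖ = ‖B (p.1, Eq360TensorInvariance.reflSrc α p.1 p.2)‖ := by
  unfold reflCfg
  rw [norm_mul, norm_axisSign, one_mul]

/-- (3.58) for `r_α` makes the probed density at `(z; (μ,x), (ν,y))` the pull-back, along the sign-twist, of the probed
density at `(r_αz; (μ, r_{α,μ}x), (ν, r_{α,ν}y))`, on the sup-ball of radius `R/2`. [cite: Balaban1988Convergent, (3.58) p.282] -/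
theorem probeFn_refl_eqOn {R : ℝ} (h358 : Eq358Refl M g R) (α : Fin d) (z : Pt d) (μ ν : Fin d) (x y : Pt d) :
    Set.EqOn (fun w => probeFn M g (reflPt α z) (μ, Eq360TensorInvariance.reflSrc α μ x)
        (ν, Eq360TensorInvariance.reflSrc α ν y) (fun i => twist α μ ν i * w i))
      (probeFn M g z (μ, x) (ν, y)) (halfBall R) := by
  intro w hw
  show density M g (reflPt α z) (probe (μ, Eq360TensorInvariance.reflSrc α μ x) (ν, Eq360TensorInvariance.reflSrc α ν y)
      (fun i => twist α μ ν i * w i)) = density M g z (probe (μ, x) (ν, y) w)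
  rw [← reflCfg_probe]
  exact h358 α z _ fun p => (norm_probe_le _ _ w p).trans_lt (norm_add_lt_of_mem_halfBall hw)

/-- (3.58) for `σ` makes the probed densities at `(z; (μ,x), (ν,y))` and at `(σz; (σμ,σx), (σν,σy))` the same function on
the sup-ball of radius `R/2`. [cite: Balaban1988Convergent, (3.58) p.282] -/
theorem probeFn_perm_eqOn {R : ℝ} (h358 : Eq358Perm M g R) (σ : Equiv.Perm (Fin d)) (z : Pt d) (μ ν : Fin d)
    (x y : Pt d) :
    Set.EqOn (probeFn M g (Eq360TensorInvariance.permPt σ z) (σ μ, Eq360TensorInvariance.permPt σ x)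
        (σ ν, Eq360TensorInvariance.permPt σ y))
      (probeFn M g z (μ, x) (ν, y)) (halfBall R) := by
  intro w hw
  unfold probeFn
  rw [← permCfg_probe]
  exact h358 σ z _ fun p => (norm_probe_le _ _ w p).trans_lt (norm_add_lt_of_mem_halfBall hw)

omit d in
/-- The sign-twist maps the sup-ball of radius `R/2` to itself. [cite: Balaban1988Convergent, (3.58) p.282] -/
theorem twist_mem_halfBall {R : ℝ} {c : Fin 2 → ℂ} (hc : ∀ i, ‖c i‖ = 1) {w : Fin 2 → ℂ} (hw : w ∈ halfBall R) :
    (fun i => c i * w i) ∈ halfBall R := fun i => by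
  show ‖c i * w i‖ < R / 2
  rw [norm_mul, hc i, one_mul]
  exact hw i

/-- **(3.59) for the axis reflections, for the whole-lattice kernel of a pointed analytic localized family**:
`Π_{μν}(x, y, z) = s_α(μ)s_α(ν)·Π_{μν}(r_{α,μ}x, r_{α,ν}y, r_αz)` — *"((r⁻¹⊗r⁻¹)Π^{(j)}_{μν})(rx, ry, rz) = Π^{(j)}_{μν}(x, y, z)"* from
(3.58) for `r_α` (the twist costs the factor `s_α(μ)s_α(ν)` in `∂₀∂₁`). [cite: Balaban1988Convergent, (3.59) p.282] -/
theorem kernelPt_refl {U : ∀ X : Finset (Pt d), Set (Fin d × ↥(sites M X) → ℂ)}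
    (hg : ∀ X z, AnalyticOnNhd ℂ (g X z) (U X)) {R E₀ κ : ℝ} (hR : 0 < R)
    (hRU : ∀ X, polydisc (fun _ => R) ⊆ U X)
    (hA : ∀ (X : LocDom d) (z : Pt d), ∀ s ∈ polydisc (fun _ : Fin d × ↥(sites M X.1) => R),
      ‖g X.1 z s‖ ≤ E₀ * Real.exp (-κ * treeLen X.1))
    (hκ : kappa₀ (4 * 2 ^ d) (2 * d) ≤ κ) (h358 : Eq358Refl M g R) (α μ ν : Fin d) (x y z : Pt d) :
    kernelPt M g μ ν x y z = B14Sect3.axisSign α μ * B14Sect3.axisSign α ν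
      * kernelPt M g μ ν (Eq360TensorInvariance.reflSrc α μ x) (Eq360TensorInvariance.reflSrc α ν y) (reflPt α z) := by
  set Φ₁ := probeFn M g (reflPt α z) (μ, Eq360TensorInvariance.reflSrc α μ x)
    (ν, Eq360TensorInvariance.reflSrc α ν y) with hΦ₁
  rw [kernelPt_eq_re_pderiv hg hR hRU hA hκ μ ν x y z, kernelPt_eq_re_pderiv hg hR hRU hA hκ μ ν
    (Eq360TensorInvariance.reflSrc α μ x) (Eq360TensorInvariance.reflSrc α ν y) (reflPt α z), ← hΦ₁]
  have hopen := isOpen_halfBall R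
  have h0 : (0 : Fin 2 → ℂ) ∈ halfBall R := fun i => by
    simp only [Pi.zero_apply, norm_zero]
    linarith
  -- the probed density at `z` is the twisted pull-back of `Φ₁`, on the sup-ball
  have heq : Set.EqOn (pderiv 1 (probeFn M g z (μ, x) (ν, y)))
      (pderiv 1 (fun w => Φ₁ (fun i => twist α μ ν i * w i))) (halfBall R) := fun v hv =>
    pderiv_congr_of_eqOn hopen (probeFn_refl_eqOn h358 α z μ ν x y).symm 1 hv
  have h2 : pderiv 0 (pderiv 1 (probeFn M g z (μ, x) (ν, y))) 0
      = pderiv 0 (pderiv 1 (fun w => Φ₁ (fun i => twist α μ ν i * w i))) 0 :=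
    pderiv_congr_of_eqOn hopen heq 0 h0
  have h3 : pderiv 1 (fun w => Φ₁ (fun i => twist α μ ν i * w i))
      = fun w => twist α μ ν 1 * pderiv 1 Φ₁ (fun i => twist α μ ν i * w i) := by
    funext w
    rw [pderiv_comp_diag]
    rfl
  have h4 : pderiv 0 (fun w => twist α μ ν 1 * pderiv 1 Φ₁ (fun i => twist α μ ν i * w i)) 0
      = twist α μ ν 1 * (twist α μ ν 0 * pderiv 0 (pderiv 1 Φ₁) 0) := by
    have h5 : pderiv 0 (fun w => pderiv 1 Φ₁ (fun i => twist α μ ν i * w i)) 0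
        = twist α μ ν 0 * pderiv 0 (pderiv 1 Φ₁) 0 := by
      rw [pderiv_comp_diag]
      simp only [smul_eq_mul, Pi.zero_apply, mul_zero]
      rfl
    rw [← h5]
    unfold pderiv
    rw [deriv_const_mul_field]
  rw [h2, h3, h4]
  simp only [twist, Matrix.cons_val_zero, Matrix.cons_val_one, Complex.mul_re, Complex.ofReal_re, Complex.ofReal_im,
    zero_mul, sub_zero]
  ring

/-- **(3.59) for the coordinate permutations**: `Π_{μν}(x, y, z) = Π_{σμ,σν}(σx, σy, σz)`, from (3.58) for `σ`.
[cite: Balaban1988Convergent, (3.59) p.282] -/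
theorem kernelPt_perm {U : ∀ X : Finset (Pt d), Set (Fin d × ↥(sites M X) → ℂ)}
    (hg : ∀ X z, AnalyticOnNhd ℂ (g X z) (U X)) {R E₀ κ : ℝ} (hR : 0 < R)
    (hRU : ∀ X, polydisc (fun _ => R) ⊆ U X)
    (hA : ∀ (X : LocDom d) (z : Pt d), ∀ s ∈ polydisc (fun _ : Fin d × ↥(sites M X.1) => R),
      ‖g X.1 z s‖ ≤ E₀ * Real.exp (-κ * treeLen X.1))
    (hκ : kappa₀ (4 * 2 ^ d) (2 * d) ≤ κ) (h358 : Eq358Perm M g R) (σ : Equiv.Perm (Fin d)) (μ ν : Fin d)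
    (x y z : Pt d) :
    kernelPt M g μ ν x y z = kernelPt M g (σ μ) (σ ν) (Eq360TensorInvariance.permPt σ x)
      (Eq360TensorInvariance.permPt σ y) (Eq360TensorInvariance.permPt σ z) := by
  rw [kernelPt_eq_re_pderiv hg hR hRU hA hκ μ ν x y z, kernelPt_eq_re_pderiv hg hR hRU hA hκ (σ μ) (σ ν)
    (Eq360TensorInvariance.permPt σ x) (Eq360TensorInvariance.permPt σ y) (Eq360TensorInvariance.permPt σ z)]
  congr 1
  have hopen := isOpen_halfBall R
  have h0 : (0 : Fin 2 → ℂ) ∈ halfBall R := fun i => by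
    simp only [Pi.zero_apply, norm_zero]
    linarith
  have heq : Set.EqOn (pderiv 1 (probeFn M g z (μ, x) (ν, y)))
      (pderiv 1 (probeFn M g (Eq360TensorInvariance.permPt σ z) (σ μ, Eq360TensorInvariance.permPt σ x)
        (σ ν, Eq360TensorInvariance.permPt σ y))) (halfBall R) := fun v hv =>
    pderiv_congr_of_eqOn hopen (probeFn_perm_eqOn h358 σ z μ ν x y).symm 1 hv
  exact pderiv_congr_of_eqOn hopen heq 0 h0

/-- **(3.59) ⇒ (3.60) ⇒ (3.61) for the whole-lattice kernel of a pointed analytic localized family, ALL covariance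
hypotheses DISCHARGED to (3.58)** (reflections and permutations) and the marginals to (2.27)(i)–(iv) (linearized (iii)):
on the indices `κ < μ`, `τ < ν` of the sum (3.57), `Π_{μν,κτ} = δ_{μν}δ_{κτ}·Π_{μ₀μ₀,κ₀κ₀}` —
`Eq360TensorInvariance.eq361_of_covariance` with `hD`, `hWx`, `hWy`, `hR`, `hP` discharged.
[cite: Balaban1988Convergent, (3.59)–(3.61) p.282] -/
theorem eq361_kernelPt (hM : 0 < M) (hd : 0 < d) {U : ∀ X : Finset (Pt d), Set (Fin d × ↥(sites M X) → ℂ)}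
    (hU : ∀ X, IsOpen (U X)) (hg : ∀ X z, AnalyticOnNhd ℂ (g X z) (U X)) {R E₀ κ : ℝ} (hR : 0 < R) (hE₀ : 0 ≤ E₀)
    (hRU : ∀ X, polydisc (fun _ => R) ⊆ U X)
    (hA : ∀ (X : LocDom d) (z : Pt d), ∀ s ∈ polydisc (fun _ : Fin d × ↥(sites M X.1) => R),
      ‖g X.1 z s‖ ≤ E₀ * Real.exp (-κ * treeLen X.1))
    (hκ : kappa₀ (4 * 2 ^ d) (2 * d) ≤ κ / 3) (hκ0 : 0 < κ)
    (hginv : ∀ (X : Finset (Pt d)) (z : Pt d) (lam : Pt d → ℝ), ∀ᶠ B in 𝓝 (0 : Fin d × ↥(sites M X) → ℂ),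
      ∀ᶠ t in 𝓝 (0 : ℂ), g X z (B + t • gaugeDir M X lam) = g X z B)
    (hrefl : Eq358Refl M g R) (hperm : Eq358Perm M g R) {μ₀ κ₀ : Fin d} (h₀ : κ₀ ≠ μ₀) :
    ∀ μ ν κ' τ, κ' < μ → τ < ν →
      P4 (kernelPt M g) μ ν κ' τ = if (μ = ν ∧ κ' = τ) then P4 (kernelPt M g) μ₀ μ₀ κ₀ κ₀ else 0 := by
  have hκ' : kappa₀ (4 * 2 ^ d) (2 * d) ≤ κ := hκ.trans (by linarith)
  have h0 : ∀ X, (0 : Fin d × ↥(sites M X) → ℂ) ∈ U X := fun X => hRU X (zero_mem_polydisc fun _ => hR.le)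
  have hE₂ : 0 ≤ 4 * E₀ / R ^ 2 := div_nonneg (mul_nonneg (by norm_num) hE₀) (pow_nonneg hR.le 2)
  have hloc : ∀ z X μ ν x y, kernelOf M (fun X => g X z) X μ ν x y ≠ 0 → coarse M x ∈ X ∧ coarse M y ∈ X :=
    fun z X μ ν x y h => kernelOf_loc hM X μ ν x y h
  have hbd : ∀ z, ∀ X : LocDom d, ∀ μ ν x y,
      |kernelOf M (fun X => g X z) X.1 μ ν x y| ≤ 4 * E₀ / R ^ 2 * Real.exp (-κ * treeLen X.1) :=
    fun z => kernelOf_bound (g := fun X => g X z) hU (fun X => hg X z) hR hE₀ hRU (fun X s hs => hA X z s hs)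
  have hD : Decay3 (kernelPt M g) (4 * E₀ / R ^ 2 * K₀ (4 * 2 ^ d) (2 * d) * Real.exp (4 * κ / 3))
      (κ / (3 * d * M)) := fun μ ν x y z =>
    decay3_threeKernel hM hE₂ hκ hκ0.le (hloc z) (hbd z) μ ν x y z
  have hr : 0 < κ / (3 * d * M) := div_pos hκ0 (by positivity)
  have hmarg : ∀ μ ν, (∀ x, ∑' y, kernelPt M g μ ν x y 0 = 0) ∧ (∀ y, ∑' x, kernelPt M g μ ν x y 0 = 0) :=
    fun μ ν => marginals_threeKernel hM hd hE₂ hκ hκ0 (hloc 0) (hbd 0)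
      (fun X μ' x' lam' _ => wardY_kernelOf hU h0 (fun X => hg X 0) (fun X lam'' => hginv X 0 lam'') X.1 μ' x' lam')
      (fun X ν' y' lam' _ => wardX_kernelOf hU h0 (fun X => hg X 0) (fun X lam'' => hginv X 0 lam'') X.1 ν' y' lam')
      μ ν
  have hRfl : ∀ α μ ν x y, kernelPt M g μ ν x y 0 = B14Sect3.axisSign α μ * B14Sect3.axisSign α ν
      * kernelPt M g μ ν (Eq360TensorInvariance.reflSrc α μ x) (Eq360TensorInvariance.reflSrc α ν y) 0 := by
    intro α μ ν x y
    have h := kernelPt_refl hg hR hRU hA hκ' hrefl α μ ν x y 0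
    rwa [reflPt_zero] at h
  have hPrm : ∀ (σ : Equiv.Perm (Fin d)) μ ν x y, kernelPt M g μ ν x y 0
      = kernelPt M g (σ μ) (σ ν) (Eq360TensorInvariance.permPt σ x) (Eq360TensorInvariance.permPt σ y) 0 := by
    intro σ μ ν x y
    have h := kernelPt_perm hg hR hRU hA hκ' hperm σ μ ν x y 0
    have hz : Eq360TensorInvariance.permPt σ (0 : Pt d) = 0 := by
      funext i
      simp [Eq360TensorInvariance.permPt]
    rwa [hz] at h
  exact Eq360TensorInvariance.eq361_of_covariance hD hr (fun μ ν y => (hmarg μ ν).2 y)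
    (fun μ ν x => (hmarg μ ν).1 x) hRfl hPrm h₀

/-! ## §7. (v1.2) The located model caveat, kernel-checked: `z`-INDEPENDENT families degenerate under `TranslInv` -/

section Caveat

open Literature.MathematicalPhysics.QuantumFieldTheory.GawedzkiKupiainen1985.PeriodicGleason (wt wt_pos l1 l1_nonneg)

variable {K : Finset (Pt d) → Fin d → Fin d → Pt d → Pt d → ℝ}

/-- In the `z`-independent model of `B14.Eq357KernelDecay` (one kernel family `K X μ ν x y` for every `z`) the whole-lattice
kernel sees `z` only through its cube. [cite: Balaban1988Convergent, p.281 (the function Π^{(j)}_{μν}(x,y,z))] -/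
theorem threeKernel_congr_coarse {z z' : Pt d} (h : coarse M z = coarse M z') (μ ν : Fin d) (x y : Pt d) :
    threeKernel M K μ ν x y z = threeKernel M K μ ν x y z' := by
  unfold threeKernel
  simp_rw [h]

/-- The cube of the origin contains `e_i` as soon as the cubes have at least two sites a side: `⌊e_i/M⌋ = 0 = ⌊0/M⌋`.
[cite: Balaban1987RG1, p.257 (cubes of a size M)] -/
theorem coarse_single_one_eq (hM : 2 ≤ M) (i : Fin d) : coarse M (Pi.single i (1 : ℤ)) = coarse M (0 : Pt d) := by
  funext j
  unfold coarse
  by_cases hj : j = i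
  · subst hj
    rw [Pi.single_eq_same, Pi.zero_apply, Int.zero_ediv]
    exact Int.ediv_eq_zero_of_lt (by norm_num) (by exact_mod_cast hM)
  · rw [Pi.single_eq_of_ne hj, Pi.zero_apply]

/-- Translation invariance PLUS cube-dependence make the `z`-independent whole-lattice kernel constant under the unit steps
`z ↦ z + e_i` (`M ≥ 2`): `Π(x, y, z + e_i) = Π(x − z, y − z, e_i) = Π(x − z, y − z, 0) = Π(x, y, z)`.
[cite: Balaban1988Convergent, p.281 (This function is translation invariant)] -/
theorem threeKernel_step_of_translInv (hM : 2 ≤ M) (hT : TranslInv (threeKernel M K)) (μ ν : Fin d) (x y z : Pt d)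
    (i : Fin d) : threeKernel M K μ ν x y (z + Pi.single i 1) = threeKernel M K μ ν x y z := by
  have h1 := hT μ ν (x - z) (y - z) (Pi.single i 1) z
  have h0 := hT μ ν (x - z) (y - z) 0 z
  rw [sub_add_cancel, sub_add_cancel, add_comm] at h1
  rw [sub_add_cancel, sub_add_cancel, zero_add] at h0
  rw [h1, h0]
  exact threeKernel_congr_coarse (coarse_single_one_eq hM i) μ ν (x - z) (y - z)

omit d in
/-- A function on `Z^d` invariant under all unit steps is constant. [cite: Balaban1988Convergent, p.281 (This function is translation invariant)] -/
theorem eq_apply_zero_of_step {d : ℕ} {f : Pt d → ℝ} (h : ∀ (z : Pt d) (i : Fin d), f (z + Pi.single i 1) = f z)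
    (z : Pt d) : f z = f 0 := by
  -- invariance under `w ↦ w + n e_i`, `n : ℤ`
  have hn : ∀ (w : Pt d) (i : Fin d) (n : ℤ), f (w + Pi.single i n) = f w := by
    intro w i n
    induction n using Int.induction_on with
    | zero => simp
    | succ n ih =>
        rw [Pi.single_add, ← add_assoc, h, ih]
    | pred n ih =>
        have hs := h (w + Pi.single i (-(n : ℤ) - 1)) i
        rw [add_assoc, ← Pi.single_add, show (-(n : ℤ) - 1 + 1) = -(n : ℤ) by ring] at hs
        rw [← hs]
        exact ih
  -- invariance under every lattice vector, by `Pi.single_induction`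
  have key : ∀ w : Pt d, ∀ v : Pt d, f (v + w) = f v := by
    intro w
    induction w using Pi.single_induction with
    | zero => intro v; rw [add_zero]
    | add a b ha hb => intro v; rw [← add_assoc, hb, ha]
    | single i m => intro v; exact hn v i m
  have := key z 0
  rwa [zero_add] at this

/-- **`TranslInv` makes the `z`-independent whole-lattice kernel independent of `z`** (`M ≥ 2`).
[cite: Balaban1988Convergent, p.281 (This function is translation invariant)] -/
theorem threeKernel_eq_apply_zero_of_translInv (hM : 2 ≤ M) (hT : TranslInv (threeKernel M K)) (μ ν : Fin d)
    (x y z : Pt d) : threeKernel M K μ ν x y z = threeKernel M K μ ν x y 0 :=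
  eq_apply_zero_of_step (fun z i => threeKernel_step_of_translInv hM hT μ ν x y z i) z

omit d in
/-- The `ℓ¹` weight of `x − ne_i` decays in `n`: `e^{−κ|x − ne_i|₁} ≤ e^{κ|x_i|}·e^{−κn}` (`κ ≥ 0`).
[cite: Balaban1988Convergent, (3.48) p.280] -/
theorem wt_sub_single_le {d : ℕ} {κ : ℝ} (hκ : 0 ≤ κ) (x : Pt d) (i : Fin d) (n : ℕ) :
    wt κ (x - Pi.single i (n : ℤ)) ≤ Real.exp (κ * |(x i : ℝ)|) * Real.exp (-κ * n) := by
  set v : Pt d := x - Pi.single i (n : ℤ) with hv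
  have hvi : (v i : ℝ) = (x i : ℝ) - n := by
    rw [hv, Pi.sub_apply, Pi.single_eq_same]
    push_cast
    ring
  unfold wt
  rw [← Real.exp_add]
  apply Real.exp_le_exp.2
  have h1 : |(v i : ℝ)| ≤ l1 v :=
    Finset.single_le_sum (f := fun j => |(v j : ℝ)|) (fun j _ => abs_nonneg _) (Finset.mem_univ i)
  rw [hvi] at h1
  have h3 : (n : ℝ) - |(x i : ℝ)| ≤ |(x i : ℝ) - n| := by
    have := abs_sub_abs_le_abs_sub (n : ℝ) (x i : ℝ)
    rw [abs_of_nonneg (Nat.cast_nonneg n), abs_sub_comm] at this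
    exact this
  have h4 : (n : ℝ) - |(x i : ℝ)| ≤ l1 v := h3.trans h1
  nlinarith [mul_le_mul_of_nonneg_left h4 hκ]

omit d in
/-- The `ℓ¹` weights are at most one (`κ ≥ 0`). [cite: Balaban1988Convergent, (3.48) p.280] -/
theorem wt_le_one {d : ℕ} {κ : ℝ} (hκ : 0 ≤ κ) (v : Pt d) : wt κ v ≤ 1 := by
  unfold wt
  apply Real.exp_le_one_iff.2
  nlinarith [l1_nonneg v, hκ]

omit d in
/-- `e^{−κn} = (e^{−κ})^n`. [cite: Balaban1988Convergent, (3.48) p.280] -/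
theorem exp_neg_mul_natCast (κ : ℝ) (n : ℕ) : Real.exp (-κ * n) = Real.exp (-κ) ^ n := by
  rw [show (-κ * (n : ℝ)) = (n : ℝ) * (-κ) by ring, Real.exp_nat_mul]

/-- **THE LOCATED MODEL CAVEAT, KERNEL-CHECKED**: in the `z`-independent model, translation invariance under all lattice
translations together with the product decay `Decay3` (rate `κ′ > 0`) force the whole-lattice kernel to VANISH IDENTICALLY
as soon as the cubes have `M ≥ 2` sites a side (`d ≥ 1`) — the kernel is independent of `z` and tends to `0` as `z → ∞`.
Hence the `z`-independent theorems carrying `TranslInv` as a hypothesis (`B14.Eq357KernelDecay.eq364_threeKernel`,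
`B14.Eq362KernelWard.eq364_threeKernel_of_ward`, `B14.Eq350KernelCauchy.eq364_kernelOf`) speak about the zero kernel only;
the faithful carrier of print's `Π^{(j)}_{μν}(x, y, z)` is the `z`-pointed `kernelPt` (§3–§6), whose translation invariance is a
THEOREM. [cite: Balaban1988Convergent, p.281 (This function is translation invariant), (2.29) p.260 (only for the unrestricted summation)] -/
theorem threeKernel_eq_zero_of_translInv (hM : 2 ≤ M) (hd : 0 < d) {C κ' : ℝ} (hκ' : 0 < κ')
    (hT : TranslInv (threeKernel M K)) (hD : Decay3 (threeKernel M K) C κ') (μ ν : Fin d) (x y z : Pt d) :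
    threeKernel M K μ ν x y z = 0 := by
  rw [threeKernel_eq_apply_zero_of_translInv hM hT μ ν x y z]
  obtain ⟨i⟩ : Nonempty (Fin d) := ⟨⟨0, hd⟩⟩
  have hC : 0 ≤ C := by
    by_contra hC'
    have hC'' : C < 0 := lt_of_not_ge hC'
    have h := hD μ ν x y 0
    have hw : 0 < wt κ' (x - 0) * wt κ' (y - 0) := mul_pos (wt_pos _ _) (wt_pos _ _)
    have hneg : C * wt κ' (x - 0) * wt κ' (y - 0) < 0 := by
      rw [mul_assoc]
      exact mul_neg_of_neg_of_pos hC'' hw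
    exact absurd (h.trans_lt hneg) (not_lt.2 (abs_nonneg _))
  -- along `z_n = ne_i` the decay bound tends to zero while the kernel keeps its value at `z = 0`
  have hbound : ∀ n : ℕ,
      |threeKernel M K μ ν x y 0| ≤ C * Real.exp (κ' * |(x i : ℝ)|) * Real.exp (-κ') ^ n := by
    intro n
    have h := hD μ ν x y (Pi.single i (n : ℤ))
    rw [threeKernel_eq_apply_zero_of_translInv hM hT μ ν x y (Pi.single i (n : ℤ))] at h
    have hw1 := wt_sub_single_le hκ'.le x i n
    have hw2 := wt_le_one hκ'.le (y - Pi.single i (n : ℤ))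
    have hB : 0 ≤ C * (Real.exp (κ' * |(x i : ℝ)|) * Real.exp (-κ' * n)) :=
      mul_nonneg hC (mul_nonneg (Real.exp_pos _).le (Real.exp_pos _).le)
    have step := mul_le_mul (mul_le_mul_of_nonneg_left hw1 hC) hw2 (wt_pos _ _).le hB
    rw [mul_one, exp_neg_mul_natCast, ← mul_assoc] at step
    exact h.trans step
  have hlim : Tendsto (fun n : ℕ => C * Real.exp (κ' * |(x i : ℝ)|) * Real.exp (-κ') ^ n) atTop (𝓝 0) := by
    have h1 : Tendsto (fun n : ℕ => Real.exp (-κ') ^ n) atTop (𝓝 0) :=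
      tendsto_pow_atTop_nhds_zero_of_lt_one (Real.exp_pos _).le (Real.exp_lt_one_iff.2 (by linarith))
    have h2 := h1.const_mul (C * Real.exp (κ' * |(x i : ℝ)|))
    rwa [mul_zero] at h2
  have hle : |threeKernel M K μ ν x y 0| ≤ 0 := ge_of_tendsto' hlim hbound
  exact abs_eq_zero.1 (le_antisymm hle (abs_nonneg _))

/-- In particular, for a `z`-INDEPENDENT analytic localized family the hypothesis `hT` of
`B14.Eq350KernelCauchy.eq364_kernelOf` forces the kernel of record there to be zero (`M ≥ 2`, `d ≥ 1`, `κ > 0`): that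
theorem is the degenerate special case of `eq364_kernelPt`. [cite: Balaban1988Convergent, p.281 (This function is translation invariant)] -/
theorem threeKernel_kernelOf_eq_zero_of_translInv (hM2 : 2 ≤ M) (hd : 0 < d)
    {g₀ : ∀ X : Finset (Pt d), (Fin d × ↥(sites M X) → ℂ) → ℂ} {U : ∀ X : Finset (Pt d), Set (Fin d × ↥(sites M X) → ℂ)}
    (hU : ∀ X, IsOpen (U X)) (hg : ∀ X, AnalyticOnNhd ℂ (g₀ X) (U X)) {R E₀ κ : ℝ} (hR : 0 < R) (hE₀ : 0 ≤ E₀)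
    (hRU : ∀ X, polydisc (fun _ => R) ⊆ U X)
    (hA : ∀ X : LocDom d, ∀ s ∈ polydisc (fun _ => R), ‖g₀ X.1 s‖ ≤ E₀ * Real.exp (-κ * treeLen X.1))
    (hκ : kappa₀ (4 * 2 ^ d) (2 * d) ≤ κ / 3) (hκ0 : 0 < κ) (hT : TranslInv (threeKernel M (kernelOf M g₀)))
    (μ ν : Fin d) (x y z : Pt d) : threeKernel M (kernelOf M g₀) μ ν x y z = 0 :=
  have hM : 0 < M := lt_of_lt_of_le (by norm_num) hM2
  threeKernel_eq_zero_of_translInv hM2 hd (div_pos hκ0 (by positivity)) hT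
    (decay3_kernelOf hM hU hg hR hE₀ hRU hA hκ hκ0.le) μ ν x y z

end Caveat

end

end Literature.MathematicalPhysics.QuantumFieldTheory.Balaban1983to89.B14.Eq358TranslInv
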